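import Literature.NumberTheory.LFunctions.RodgersTaoTailSumProofs
import Literature.NumberTheory.LFunctions.RodgersTaoZeroSet
import Literature.NumberTheory.LFunctions.RodgersTaoRiemannVonMangoldtProofs
import Literature.Analysis.Complex.BacklundJensenAverage
import Literature.Analysis.Complex.BacklundTrick
import HarnessLib

/-!
# Rodgers–Tao 2020, Theorem 3.2 (48): the Riemann–von Mangoldt formula for `H_t` — RH-FREE CONTENT TWIN

Trunk T-ANT (`Literature/NumberTheory/LFunctions`). PROOFS ONLY: no definition, no named fact.
LINE 1 — LABEL: RH-FREE literature (Rodgers–Tao 2020, §3); bears_on LADDER-RH N-C/N-P (COLUMN 3,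
DBN). WHAT THIS IS NOT: a zero-counting formula for `H_t` at a time `t` lying above a real-rooted
time is vacuous for `ζ` at `t < 0` (the tree proves `Λ ≥ 0`, `rodgers_tao_holds`) and is the
Riemann hypothesis' business at `t = 0`; formalising the printed §3 argument fixes the RH-free
chain (48) ⟹ (50) ⟹ (52) ⟹ (59) of the source, it does not move RH. Nothing in this file bears on
the truth of RH.

## The source

B. Rodgers, T. Tao, *The de Bruijn–Newman constant is non-negative*, Forum Math. Pi 8 (2020) e6
(= arXiv:1801.05914v5), **Theorem 9** (= Theorem 3.2 of arXiv v4), p. 23: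

> THEOREM 9 (Riemann–von Mangoldt type formulae). Let `Λ < t ⩽ 0`, `T > 0`, and let
> `0 ⩽ α ⩽ C` for some `C > 0`. Then one has `N_t([0, T]) = Ψ(T) + O(log²₊ T)` (48) and
> `N_t([T, T + α log₊ T]) = α log²₊ T/4π + o_{T→∞}(log²₊ T)`. (49)

Here `N_t(I)` = `deBruijnZeroCount t I` (number of real zeros of `H_t` in `I`),
`Ψ(T) = (T/4π) log(T/4π) − T/4π` = `rodgersTaoPsi`, `log₊ x = log(2 + |x|)` = `logPlus` (all tree
carriers; `RodgersTao2020.logPlus = logPlus` by `rfl`). The as-printed fact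
`RodgersTao2020.thm32_bigO` (range «`Λ < t ≤ 0`») is VACUOUS-AS-PRINTED and proved EX FALSO in
`RodgersTaoRiemannVonMangoldt.lean`; this file proves its CONTENT.

## What is proved (eq. (48) only; (49) is not treated here)

* `RodgersTao2020.thm32_bigO_of_asymptotics` — the schema: at ONE time `t`, if all zeros of `H_t`
  are real and simple and the inner shapes of the §2 estimates hold at `t` — the majorant (7)
  (`‖H_t(x − iκ′log₊ x)‖ ≤ e^{−πx/8 + A log₊² x}`, `0 ≤ κ′ ≤ C₇`), the lower half of (8) and the
  logarithmic-derivative asymptotics (9) at one `κ > 0` for `x ≥ C″` — then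
  `|N_t([0,T]) − Ψ(T)| ≤ A′ log₊² T` for all `T > 0`, with `A′` depending on `κ, C″, A` only
  (quantified BEFORE `t`).
* `RodgersTao2020.thm32_bigO_inner` — the corollary over the kernel theorems
  `rodgersTao_H_bound_holds` (7), `rodgersTao_H_asymp_holds` (8),
  `rodgersTao_logDeriv_H_asymp_holds` (9) (`RodgersTaoAsymptoticsProofs.lean`,
  `RodgersTaoTailSumProofs.lean`), de Bruijn monotonicity and Csordas–Smith–Varga simplicity:
  `∀ T₀, ∃ A, ∀ t ∈ [−T₀, 0]` above a real-rooted time, `∀ T > 0, |N_t([0,T]) − Ψ(T)| ≤ A log₊² T`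
  — verbatim the hypothesis `h48` of `RodgersTao2020.cor33_location_of_count_estimate`
  (`RodgersTaoRiemannVonMangoldtProofs.lean`).

## The printed proof (FMP pp. 24–25 = arXiv v5 ll. 629–664) and its map onto this file

«We make use of the argument principle … By perturbing `T` slightly if necessary, we may assume
that `T` is not a zero of `H_t`. … `N_t([0,T]) = (1/π) Im (∫_{Γ_I} + ∫_{Γ_II}) H_t′/H_t (z) dz`»
(`Γ_I : x − iκ log₊ x`, `0 ≤ x ≤ T`; `Γ_II`: the vertical segment from `T − iκ log₊ T` to `T`);
«From (9) and (39) one sees that `(1/π)(H_t′/H_t)(z) = (d/dz)(Ψ(iz)) + O(log₊ x/x)` … hence by the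
fundamental theorem of calculus `(1/π) Im ∫_{Γ_I} H_t′/H_t = Im Ψ(iT + κ log₊ T) − Ψ(log₊ 0) +
O(log²₊ T) = Ψ(T) + O(log²₊ T)`»; on `Γ_II` the change of `arg e^{iθ}H_t` is at most `π(m + 1)`,
`m ≤ m′` = the number of zeros of `g(s) = ½(e^{−iθ}H_t(is + T) + e^{iθ}H_t(−is + T))` in the disc
of radius `κ log₊ T` about `κ log₊ T`, and «it therefore follows from the Jensen formula … that
`m′ ≪ log²₊ T`» (p. 25), using (7) for the maximum and (8) at the centre.

* §A–§D (`RodgersTaoZeroCounting.*`): **the argument principle for `H_t`**, realised through the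
  tree's grouped Hadamard product `H_t(z) = H_t(0) ∏ (1 + b_n z²)` (`IsHadamardSeq`,
  `DeBruijnHLogDerivSeries.lean`): real zeros make `b_n = β_n ≤ 0` real
  (`exists_real_isHadamardSeq`); `L(z) = Σ log(1 + β_n z²)` is a holomorphic logarithm of
  `H_t/H_t(0)` on the open lower half-plane with `L′ = H_t′/H_t` (`hasDerivAt_tsum_log`), extends
  continuously to the real non-zeros (`continuousWithinAt_tsum_log`), and
  `Im L(u) = π · N_t((0,u))` there (`im_tsum_log_ofReal`, `ncard_zeros_Ioo_eq_card`, simplicity via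
  `IsHadamardSeq.analyticOrderAt_eq_mult`). Hence `∫_γ H_t′/H_t = L(end) − L(start)` along `Γ_I`
  (`integral_logDeriv_curve`) and along vertical segments (`integral_logDeriv_vertical`) — §E.
* §F: `abs_im_vertical_le` — the `Γ_II` step: Backlund's lemma of the tree
  (`Literature.Analysis.Complex.abs_im_integral_logDeriv_le_backlund'`, Jensen inside) applied to
  `g(w) = e^{πu/8} H_t(u − iw)`, with `M ≤ e^{πκ log₊ u/4 + 4A log₊² u}` from (7) (transported to
  arbitrary points by the symmetries `‖H_t(z)‖ = ‖H_t(|Re z| − i|Im z|)‖`,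
  `norm_deBruijnH_eq_norm_rodgersTaoZ`) and `|g(κ log₊ u)| ≥ e^{−A log₊² u}` from (8);
  `ncard_small_zeros_mul_log_two_le` — Jensen's formula
  (`Literature.Analysis.Complex.sum_log_div_le_circleAverage_sub`) for the zeros below `X₀ + 1`.
* §G: the `Γ_I` step: `hasDerivAt_psiC_curve` (the exact primitive `π Ψ(iγ(x))` of the main term
  of (9)), `integral_mainTerm_curve`, `norm_integral_error_le` (`∫ log₊ x/x ≪ log₊² T`),
  `abs_im_psiC_sub_psi_le` (`Im Ψ(iT + κ log₊ T) = Ψ(T) + O(log₊ T)`), `exists_zero_free_right`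
  (perturbing `T`), `abs_rodgersTaoPsi_sub_le` ((39): `Ψ′ = log(·/4π)/4π`).
* §H–§I: assembly (`abs_count_sub_psi_le_of_large`) and the two theorems.

## Divergence from print (declared)

(D1) No residue theorem is used: the identity `N_t([0,T]) = (1/π) Im ∫ H_t′/H_t` is obtained from
the Hadamard product (each factor `1 − z²/x_n²` of a zero `x_n < T` contributes `arg = π` at the
real end point, the others `0`) — the same mathematics as the printed contour, which the source
itself reduces to `Γ_I ∪ Γ_II` by oddness and conjugation symmetry. (D2) The typed (9)
(`rodgersTao_logDeriv_H_asymp`) holds for `x ≥ C″` only (its typed divergence), whereas the printed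
contour starts at `x = 0`; the twin starts `Γ_I` at `X₀ = max(C″, (8κ + 2)² + 16)` (perturbed to a
non-zero `X₁ ∈ (X₀, X₀ + 1]`) and pays `O(1)`, uniformly in `t`, for `N_t((0, X₁))` and for the
vertical segment at `X₁`, both by Jensen's formula with (7)/(8) — so the constant `A′` depends on
`κ, C″, A` but not on `t`. (D3) Constants are explicit throughout (`log 2`-denominators from Jensen
on discs of radii `r, 2r`). (D4) Eq. (49) (the `o(log²₊ T)` short-interval count, proved in print
by a normal-families argument) is NOT formalised here.

## References

* B. Rodgers, T. Tao, *The de Bruijn–Newman constant is non-negative*, Forum Math. Pi 8 (2020),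
  e6, Theorem 9 = arXiv:1801.05914v4 Theorem 3.2, eq. (48), proof pp. 24–25. [RodgersTaoFMP2020]
* G. Csordas, W. Smith, R. S. Varga, *Lehmer pairs of zeros, the de Bruijn–Newman constant Λ, and
  the Riemann Hypothesis*, Constr. Approx. 10 (1994), Thm. 2.2 (simple zeros). [CsordasSmithVarga1994]
* D. H. J. Polymath, *Effective approximation of heat flow evolution of the Riemann ξ function, and
  a new upper bound for the de Bruijn–Newman constant*, Res. Math. Sci. 6 (2019), §3 (Hadamard
  product of `H_t`). [Polymath2019]
* E. C. Titchmarsh, *The Theory of the Riemann Zeta-Function*, 2nd ed., §9.4 (Backlund's argument).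
  [Titchmarsh1986]
-/

noncomputable section

open Complex Set Filter Topology Metric MeasureTheory
open scoped Real

namespace Literature.NumberTheory.LFunctions

namespace RodgersTaoZeroCounting

/-! ## A. Real zeros make the grouped Hadamard sequence real and non-positive -/

/-- If all zeros of `H_t` are real, every coefficient `b_n` of a grouped Hadamard sequence
(`H_t(z)/H_t(0) = ∏ (1 + b_n z²)`) is a real number `≤ 0` (namely `0` or `−1/x²` for a real zero
`x`). [cite: RodgersTaoFMP2020, §3 p.20 («the zeros of H_t are all real and simple»)] -/
theorem exists_real_of_isHadamardSeq {t : ℝ} {b : ℕ → ℂ} (h : IsHadamardSeq t b)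
    (hreal : HasOnlyRealZeros (deBruijnH t)) (n : ℕ) :
    ∃ β : ℝ, β ≤ 0 ∧ b n = (β : ℂ) := by
  by_cases hb : b n = 0
  · exact ⟨0, le_rfl, by simp [hb]⟩
  obtain ⟨ζ, hζ⟩ : ∃ ζ : ℂ, ζ ^ 2 = -1 / b n :=
    ⟨(-1 / b n) ^ ((2 : ℕ) : ℂ)⁻¹, Complex.cpow_nat_inv_pow _ two_ne_zero⟩
  have hfac : 1 + b n * ζ ^ 2 = 0 := by
    rw [hζ]; field_simp; ring
  have hz : deBruijnH t ζ = 0 := h.eq_zero_of_factor hfac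
  have hζim : ζ.im = 0 := hreal ζ hz
  have hζne : ζ ≠ 0 := ne_zero_of_deBruijnH_eq_zero hz
  have hζre : ζ = (ζ.re : ℂ) := Complex.ext (by simp) (by simp [hζim])
  have hζre0 : ζ.re ≠ 0 := by
    intro h0; apply hζne; rw [hζre, h0, Complex.ofReal_zero]
  have hζ2 : ζ ^ 2 ≠ 0 := pow_ne_zero _ hζne
  have hbn : b n = -1 / ζ ^ 2 := by
    rw [hζ]; field_simp
  refine ⟨-1 / ζ.re ^ 2, ?_, ?_⟩
  · have : 0 < ζ.re ^ 2 := by positivity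
    exact div_nonpos_of_nonpos_of_nonneg (by norm_num) this.le
  · rw [hbn]
    conv_lhs => rw [hζre]
    push_cast; ring

/-- Package: under real zeros there is a REAL non-positive Hadamard sequence `β` for `H_t`.
[cite: RodgersTaoFMP2020, §3 p.20 («the zeros of H_t are all real and simple»)] -/
theorem exists_real_isHadamardSeq {t : ℝ} (hreal : HasOnlyRealZeros (deBruijnH t)) :
    ∃ β : ℕ → ℝ, (∀ n, β n ≤ 0) ∧ IsHadamardSeq t (fun n ↦ (β n : ℂ)) := by
  obtain ⟨b, hb⟩ := exists_isHadamardSeq t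
  choose β hβ0 hβ using fun n ↦ exists_real_of_isHadamardSeq hb hreal n
  have e : b = fun n ↦ (β n : ℂ) := funext hβ
  exact ⟨β, hβ0, e ▸ hb⟩

/-! ## B. The factors `1 + β z²` on the open lower half-plane and on the real axis -/

/-- For `β ≤ 0` real and `Im z < 0`, `1 + β z²` lies in the slit plane `ℂ ∖ (−∞, 0]`.
[folklore] -/
private theorem one_add_mul_sq_mem_slitPlane {β : ℝ} (hβ : β ≤ 0) {z : ℂ} (hz : z.im < 0) :
    1 + (β : ℂ) * z ^ 2 ∈ slitPlane := by
  rw [mem_slitPlane_iff]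
  have hre : (1 + (β : ℂ) * z ^ 2).re = 1 + β * (z.re ^ 2 - z.im ^ 2) := by
    rw [sq]; simp only [add_re, one_re, mul_re, mul_im, ofReal_re, ofReal_im]; ring
  have him : (1 + (β : ℂ) * z ^ 2).im = β * (2 * z.re * z.im) := by
    rw [sq]; simp only [add_im, one_im, mul_re, mul_im, ofReal_re, ofReal_im]; ring
  by_cases hx : z.re = 0
  · left
    rw [hre, hx]
    nlinarith [sq_nonneg z.im]
  · rcases hβ.eq_or_lt with h0 | hneg
    · left; rw [hre, h0]; simp
    · right
      rw [him]
      have : 2 * z.re * z.im ≠ 0 := by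
        apply mul_ne_zero (mul_ne_zero two_ne_zero hx) hz.ne
      exact mul_ne_zero hneg.ne this

/-- For `β ≤ 0` real and `Im z < 0`, `Re z > 0`: `Im (1 + β z²) ≥ 0`. [folklore] -/
private theorem one_add_mul_sq_im_nonneg {β : ℝ} (hβ : β ≤ 0) {z : ℂ} (hz : z.im ≤ 0) (hx : 0 ≤ z.re) :
    0 ≤ (1 + (β : ℂ) * z ^ 2).im := by
  have him : (1 + (β : ℂ) * z ^ 2).im = β * (2 * z.re * z.im) := by
    rw [sq]; simp only [add_im, one_im, mul_re, mul_im, ofReal_re, ofReal_im]; ring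
  rw [him]
  have : 2 * z.re * z.im ≤ 0 := by nlinarith
  nlinarith

/-- At a real point the factor is the real number `1 + β u²`. [folklore] -/
private theorem one_add_mul_sq_ofReal (β u : ℝ) :
    1 + (β : ℂ) * (u : ℂ) ^ 2 = ((1 + β * u ^ 2 : ℝ) : ℂ) := by
  push_cast; ring

/-- Norm bound for the tail terms: `‖log(1 + β z²)‖ ≤ (3/2)‖β‖R²` when `‖z‖ ≤ R` and
`‖β‖ R² ≤ 1/2`. [folklore] -/
private theorem norm_log_one_add_mul_sq_le {β : ℝ} {R : ℝ} {z : ℂ} (hz : ‖z‖ ≤ R)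
    (hβR : ‖β‖ * R ^ 2 ≤ 1 / 2) :
    ‖Complex.log (1 + (β : ℂ) * z ^ 2)‖ ≤ 3 / 2 * (‖β‖ * R ^ 2) := by
  have hR : 0 ≤ R := (norm_nonneg z).trans hz
  have h1 : ‖(β : ℂ) * z ^ 2‖ ≤ ‖β‖ * R ^ 2 := by
    rw [norm_mul, Complex.norm_real, norm_pow]
    gcongr
  have h2 : ‖(β : ℂ) * z ^ 2‖ ≤ 1 / 2 := h1.trans hβR
  exact (Complex.norm_log_one_add_half_le_self h2).trans (by gcongr)

/-- Eventually (in `n`) `‖β_n‖ R² ≤ 1/2` (`β_n → 0`). [folklore] -/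
private theorem eventually_small {β : ℕ → ℝ} (hs : Summable fun n ↦ ‖(β n : ℂ)‖) (R : ℝ) :
    ∀ᶠ n in cofinite, ‖β n‖ * R ^ 2 ≤ 1 / 2 := by
  have hs' : Summable fun n ↦ ‖β n‖ := by simpa [Complex.norm_real] using hs
  have ht : Tendsto (fun n ↦ ‖β n‖ * R ^ 2) cofinite (𝓝 0) := by
    simpa using (hs'.tendsto_cofinite_zero).mul_const (R ^ 2)
  exact ht.eventually (ge_mem_nhds (by norm_num : (0 : ℝ) < 1 / 2))

/-- The indices with `‖β_n‖ R² > 1/2` form a finite set. [folklore] -/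
private theorem finite_large {β : ℕ → ℝ} (hs : Summable fun n ↦ ‖(β n : ℂ)‖) (R : ℝ) :
    {n : ℕ | 1 / 2 < ‖β n‖ * R ^ 2}.Finite := by
  have h := Filter.eventually_cofinite.1 (eventually_small hs R)
  exact h.subset fun n hn ↦ by simpa using hn

/-- The log-series is summable at every point. [folklore] -/
private theorem summable_log {β : ℕ → ℝ} (hs : Summable fun n ↦ ‖(β n : ℂ)‖) (z : ℂ) :
    Summable fun n ↦ Complex.log (1 + (β n : ℂ) * z ^ 2) := by
  have hs' : Summable fun n ↦ ‖β n‖ := by simpa [Complex.norm_real] using hs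
  refine Summable.of_norm_bounded_eventually (g := fun n ↦ 3 / 2 * (‖β n‖ * ‖z‖ ^ 2))
    ((hs'.mul_right _).mul_left _) ?_
  exact (eventually_small hs ‖z‖).mono fun n hn ↦ norm_log_one_add_mul_sq_le le_rfl hn

/-! ## C. The Hadamard logarithm `L(z) = Σ_n log(1 + β_n z²)`

`L` is written out as `fun z ↦ ∑' n, Complex.log (1 + (β n : ℂ) * z ^ 2)` throughout (no
definition is introduced). -/

section HadamardLog

variable {t : ℝ} {β : ℕ → ℝ}

/-- `exp L(z) = H_t(z)/H_t(0)` wherever `H_t(z) ≠ 0`. [cite: RodgersTaoFMP2020, §3 proof of (48) p.24] -/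
theorem exp_tsum_log_eq (h : IsHadamardSeq t (fun n ↦ (β n : ℂ))) {z : ℂ}
    (hz : deBruijnH t z ≠ 0) :
    Complex.exp (∑' n, Complex.log (1 + (β n : ℂ) * z ^ 2)) = deBruijnH t z / deBruijnH t 0 := by
  rw [Complex.cexp_tsum_eq_tprod (fun n ↦ h.factor_ne_zero hz n) (summable_log h.summable z)]
  exact h.tprod_eq z

/-- Decomposition `L = Σ_{n ∈ F} + Σ'_{n ∉ F}` for any finite `F`. [folklore] -/
private theorem tsum_log_eq_sum_add_tsum_compl (hs : Summable fun n ↦ ‖(β n : ℂ)‖) (F : Finset ℕ) :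
    (fun z : ℂ ↦ ∑' n, Complex.log (1 + (β n : ℂ) * z ^ 2)) =
      fun z ↦ ∑ n ∈ F, Complex.log (1 + (β n : ℂ) * z ^ 2) +
        ∑' n : ↥((F : Set ℕ)ᶜ), Complex.log (1 + (β n : ℂ) * z ^ 2) := by
  funext z
  exact ((summable_log hs z).sum_add_tsum_compl (s := F)).symm

/-- A tail factor `1 + β z²` with `‖β‖ R² ≤ 1/2`, `‖z‖ < R` lies in the slit plane (it is within
`1/2` of `1`). [folklore] -/
private theorem one_add_mul_sq_mem_slitPlane_of_small {β R : ℝ} {z : ℂ} (hz : ‖z‖ ≤ R)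
    (hβR : ‖β‖ * R ^ 2 ≤ 1 / 2) : 1 + (β : ℂ) * z ^ 2 ∈ slitPlane := by
  rw [mem_slitPlane_iff]; left
  have hR : 0 ≤ R := (norm_nonneg z).trans hz
  have h1 : ‖(β : ℂ) * z ^ 2‖ ≤ 1 / 2 := by
    rw [norm_mul, Complex.norm_real, norm_pow]
    exact (mul_le_mul_of_nonneg_left (pow_le_pow_left₀ (norm_nonneg _) hz 2) (norm_nonneg _)).trans hβR
  have h2 : |((β : ℂ) * z ^ 2).re| ≤ 1 / 2 := (abs_re_le_norm _).trans h1
  have h3 : -(1 / 2) ≤ ((β : ℂ) * z ^ 2).re := (abs_le.1 h2).1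
  simp only [add_re, one_re]
  linarith

/-- The tail of `L` beyond the finite set `{n : ‖β_n‖ R² > 1/2}` is holomorphic on the ball
`‖z‖ < R`. [folklore] -/
private theorem differentiableOn_tail (hs : Summable fun n ↦ ‖(β n : ℂ)‖) (R : ℝ) :
    DifferentiableOn ℂ (fun z ↦ ∑' n : ↥(((finite_large hs R).toFinset : Set ℕ)ᶜ),
      Complex.log (1 + (β n : ℂ) * z ^ 2)) (ball 0 R) := by
  have hs' : Summable fun n ↦ ‖β n‖ := by simpa [Complex.norm_real] using hs
  have hsmall : ∀ n : ↥(((finite_large hs R).toFinset : Set ℕ)ᶜ), ‖β n‖ * R ^ 2 ≤ 1 / 2 := by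
    rintro ⟨n, hn⟩
    simp only [Set.mem_compl_iff, Finset.mem_coe, Set.Finite.mem_toFinset, Set.mem_setOf_eq,
      not_lt] at hn
    exact hn
  refine Complex.differentiableOn_tsum_of_summable_norm
    (u := fun n : ↥(((finite_large hs R).toFinset : Set ℕ)ᶜ) ↦ 3 / 2 * (‖β n‖ * R ^ 2))
    (((hs'.mul_right _).mul_left _).subtype _) (fun n ↦ ?_) isOpen_ball (fun n w hw ↦ ?_)
  · intro w hw
    have hw' : ‖w‖ ≤ R := (mem_ball_zero_iff.1 hw).le
    have hf : DifferentiableAt ℂ (fun w : ℂ ↦ 1 + (β n : ℂ) * w ^ 2) w := by fun_prop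
    exact (hf.clog (one_add_mul_sq_mem_slitPlane_of_small hw' (hsmall n))).differentiableWithinAt
  · exact norm_log_one_add_mul_sq_le (mem_ball_zero_iff.1 hw).le (hsmall n)

/-- `L` is complex-differentiable at every point of the open lower half-plane.
[cite: RodgersTaoFMP2020, §3 proof of (48) p.24] -/
theorem differentiableAt_tsum_log (hs : Summable fun n ↦ ‖(β n : ℂ)‖) (hβ : ∀ n, β n ≤ 0)
    {z : ℂ} (hz : z.im < 0) :
    DifferentiableAt ℂ (fun w : ℂ ↦ ∑' n, Complex.log (1 + (β n : ℂ) * w ^ 2)) z := by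
  set R : ℝ := ‖z‖ + 1 with hR
  rw [tsum_log_eq_sum_add_tsum_compl hs (finite_large hs R).toFinset]
  refine DifferentiableAt.add ?_ ?_
  · refine DifferentiableAt.fun_sum fun n _ ↦ ?_
    have hf : DifferentiableAt ℂ (fun w : ℂ ↦ 1 + (β n : ℂ) * w ^ 2) z := by fun_prop
    exact hf.clog (one_add_mul_sq_mem_slitPlane (hβ n) hz)
  · exact (differentiableOn_tail hs R).differentiableAt
      (isOpen_ball.mem_nhds (mem_ball_zero_iff.2 (by rw [hR]; linarith)))

/-- **`L' = H_t'/H_t` on the open lower half-plane** (real zeros: `H_t ≠ 0` there).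
[cite: RodgersTaoFMP2020, §3 proof of (48) p.24] -/
theorem hasDerivAt_tsum_log (h : IsHadamardSeq t (fun n ↦ (β n : ℂ))) (hβ : ∀ n, β n ≤ 0)
    (hreal : HasOnlyRealZeros (deBruijnH t)) {z : ℂ} (hz : z.im < 0) :
    HasDerivAt (fun w : ℂ ↦ ∑' n, Complex.log (1 + (β n : ℂ) * w ^ 2))
      (deriv (deBruijnH t) z / deBruijnH t z) z := by
  have hd := (differentiableAt_tsum_log h.summable hβ hz).hasDerivAt
  set L : ℂ → ℂ := fun w ↦ ∑' n, Complex.log (1 + (β n : ℂ) * w ^ 2) with hL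
  -- `H ≠ 0` on the open lower half-plane
  have hne : ∀ w : ℂ, w.im < 0 → deBruijnH t w ≠ 0 := fun w hw h0 ↦ (hreal w h0 ▸ hw).false
  have h0 : deBruijnH t 0 ≠ 0 := deBruijnH_apply_zero_ne_zero t
  -- `exp ∘ L = H/H(0)` near `z`
  have hev : (fun w ↦ Complex.exp (L w)) =ᶠ[𝓝 z] fun w ↦ deBruijnH t w / deBruijnH t 0 := by
    have hopen : IsOpen {w : ℂ | w.im < 0} := isOpen_lt continuous_im continuous_const
    filter_upwards [hopen.mem_nhds hz] with w hw
    exact exp_tsum_log_eq h (hne w hw)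
  have h1 : HasDerivAt (fun w ↦ Complex.exp (L w)) (Complex.exp (L z) * deriv L z) z := hd.cexp
  have h2 : HasDerivAt (fun w ↦ deBruijnH t w / deBruijnH t 0)
      (deriv (deBruijnH t) z / deBruijnH t 0) z := by
    have := ((differentiable_deBruijnH_holds t) z).hasDerivAt
    simpa using this.div_const (deBruijnH t 0)
  have h12 : Complex.exp (L z) * deriv L z = deriv (deBruijnH t) z / deBruijnH t 0 :=
    h1.unique (hev.hasDerivAt_iff.2 h2)
  rw [exp_tsum_log_eq h (hne z hz)] at h12
  have hHz := hne z hz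
  have : deriv L z = deriv (deBruijnH t) z / deBruijnH t z := by
    field_simp at h12
    field_simp
    linear_combination h12
  rw [← this]
  exact hd

/-- Continuity of `L` at a real point `u > 0` with `H_t(u) ≠ 0`, from the open lower half-plane:
each of the finitely many factors that are negative at `u` is approached from `Im ≥ 0`, where the
principal logarithm is continuous up to the cut. [cite: RodgersTaoFMP2020, §3 proof of (48) p.24] -/
theorem continuousWithinAt_tsum_log (h : IsHadamardSeq t (fun n ↦ (β n : ℂ))) (hβ : ∀ n, β n ≤ 0)
    {u : ℝ} (hu : 0 < u) (hHu : deBruijnH t u ≠ 0) :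
    ContinuousWithinAt (fun w : ℂ ↦ ∑' n, Complex.log (1 + (β n : ℂ) * w ^ 2))
      {w : ℂ | w.im < 0} (u : ℂ) := by
  set R : ℝ := u + 1 with hR
  rw [tsum_log_eq_sum_add_tsum_compl h.summable (finite_large h.summable R).toFinset]
  refine ContinuousWithinAt.add ?_ ?_
  · -- the finite part, term by term
    refine tendsto_finsetSum _ fun n _ ↦ ?_
    have hfac : 1 + (β n : ℂ) * (u : ℂ) ^ 2 ≠ 0 := h.factor_ne_zero hHu n
    rw [one_add_mul_sq_ofReal] at hfac
    have hr0 : 1 + β n * u ^ 2 ≠ 0 := fun h0 ↦ hfac (by rw [h0]; simp)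
    have hg : Continuous fun w : ℂ ↦ 1 + (β n : ℂ) * w ^ 2 := by fun_prop
    rcases lt_or_gt_of_ne hr0 with hneg | hpos
    · -- negative factor: approach from `Im ≥ 0`
      have hlog : ContinuousWithinAt Complex.log {ζ : ℂ | 0 ≤ ζ.im}
          (1 + (β n : ℂ) * (u : ℂ) ^ 2) := by
        rw [one_add_mul_sq_ofReal]
        exact continuousWithinAt_log_of_re_neg_of_im_zero (by rw [ofReal_re]; exact hneg)
          (by rw [ofReal_im])
      have hcomp : ContinuousWithinAt (Complex.log ∘ fun w : ℂ ↦ 1 + (β n : ℂ) * w ^ 2)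
          ({w : ℂ | w.im < 0} ∩ {w : ℂ | 0 < w.re}) (u : ℂ) :=
        ContinuousWithinAt.comp (f := fun w : ℂ ↦ 1 + (β n : ℂ) * w ^ 2) (g := Complex.log)
          hlog hg.continuousWithinAt fun w hw ↦
            (one_add_mul_sq_im_nonneg (hβ n) (le_of_lt hw.1) (le_of_lt hw.2) :
              (1 + (β n : ℂ) * w ^ 2) ∈ {ζ : ℂ | 0 ≤ ζ.im})
      refine hcomp.mono_of_mem_nhdsWithin (inter_mem_nhdsWithin _ ?_)
      exact (isOpen_lt continuous_const continuous_re).mem_nhds (by simpa using hu)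
    · -- positive factor: the logarithm is continuous there
      have hsl : 1 + (β n : ℂ) * (u : ℂ) ^ 2 ∈ slitPlane := by
        rw [one_add_mul_sq_ofReal, mem_slitPlane_iff]; left; rw [ofReal_re]; exact hpos
      exact (hg.continuousAt.clog hsl).continuousWithinAt
  · -- the tail is holomorphic on `‖w‖ < u + 1`
    have hmem : (u : ℂ) ∈ ball (0 : ℂ) R := by
      rw [mem_ball_zero_iff, Complex.norm_real, Real.norm_eq_abs, abs_of_pos hu, hR]; linarith
    exact ((differentiableOn_tail h.summable R).differentiableAt
      (isOpen_ball.mem_nhds hmem)).continuousAt.continuousWithinAt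

/-- **The argument of the Hadamard product at a real point**: `Im L(u) = π · #{n : 1 + β_n u² < 0}`
(each factor is real; the negative ones have argument `π`). [cite: RodgersTaoFMP2020, §3 proof of (48) p.24] -/
theorem im_tsum_log_ofReal (hs : Summable fun n ↦ ‖(β n : ℂ)‖) (u : ℝ) (F : Finset ℕ)
    (hF : ∀ n, n ∈ F ↔ 1 + β n * u ^ 2 < 0) :
    (∑' n, Complex.log (1 + (β n : ℂ) * (u : ℂ) ^ 2)).im = π * F.card := by
  rw [Complex.im_tsum (summable_log hs u)]
  have hterm : ∀ n, (Complex.log (1 + (β n : ℂ) * (u : ℂ) ^ 2)).im = if n ∈ F then π else 0 := by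
    intro n
    rw [one_add_mul_sq_ofReal, Complex.log_im]
    split_ifs with hn
    · exact Complex.arg_ofReal_of_neg ((hF n).1 hn)
    · exact Complex.arg_ofReal_of_nonneg (not_lt.1 (mt (hF n).2 hn))
  simp_rw [hterm]
  rw [tsum_eq_sum (s := F) (fun n hn ↦ if_neg hn),
    Finset.sum_congr rfl (fun n hn ↦ if_pos hn), Finset.sum_const, nsmul_eq_mul, mul_comm]

/-! ## D. Counting: indices with a negative factor at `u` ↔ zeros of `H_t` in `(0, u)` -/

/-- For simple real zeros, `#{n : 1 + β_n u² < 0} = N_t((0, u))`: the map `n ↦ x_n = √(−1/β_n)`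
is a bijection onto the zeros in `(0, u)` (injective because a zero of multiplicity `m` is hit by
exactly `m` indices, `IsHadamardSeq.analyticOrderAt_eq_mult`, and the zeros are simple).
[cite: RodgersTaoFMP2020, §3 p.20 («the zeros of H_t are all real and simple [11, Corollary 1]»)] -/
theorem ncard_zeros_Ioo_eq_card (h : IsHadamardSeq t (fun n ↦ (β n : ℂ)))
    (hsimple : ∀ x : ℝ, deBruijnH t x = 0 → deriv (deBruijnH t) x ≠ 0) {u : ℝ} (hu : 0 < u)
    (F : Finset ℕ) (hF : ∀ n, n ∈ F ↔ 1 + β n * u ^ 2 < 0) :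
    {x : ℝ | x ∈ Ioo 0 u ∧ deBruijnH t x = 0}.ncard = F.card := by
  -- a vanishing real factor pins down `β_n`
  have hfacR : ∀ (n : ℕ) (x : ℝ), 1 + (β n : ℂ) * (x : ℂ) ^ 2 = 0 ↔ 1 + β n * x ^ 2 = 0 := by
    intro n x
    rw [one_add_mul_sq_ofReal]
    exact ⟨fun h0 ↦ by exact_mod_cast h0, fun h0 ↦ by rw [h0]; simp⟩
  have key : {x : ℝ | x ∈ Ioo 0 u ∧ deBruijnH t x = 0} =
      (fun n : ℕ ↦ Real.sqrt (-1 / β n)) '' (F : Set ℕ) := by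
    ext x
    constructor
    · rintro ⟨⟨hx0, hxu⟩, hx⟩
      obtain ⟨n, hn⟩ := Finset.card_pos.1 (h.mult_pos hx)
      rw [IsHadamardSeq.mem_zeroIndices, hfacR] at hn
      have hβx : β n * x ^ 2 = -1 := by linarith
      have hβneg : β n < 0 := by nlinarith [sq_nonneg x]
      refine ⟨n, ?_, ?_⟩
      · rw [Finset.mem_coe, hF]
        have hx2 : x ^ 2 < u ^ 2 := by nlinarith
        nlinarith [mul_lt_mul_of_neg_left hx2 hβneg]
      · have : -1 / β n = x ^ 2 := by
          rw [eq_comm, eq_div_iff hβneg.ne]; linarith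
        show Real.sqrt (-1 / β n) = x
        rw [this, Real.sqrt_sq hx0.le]
    · rintro ⟨n, hn, rfl⟩
      rw [Finset.mem_coe, hF] at hn
      have hβneg : β n < 0 := by nlinarith [sq_nonneg u]
      have hq : 0 < -1 / β n := div_pos_of_neg_of_neg (by norm_num) hβneg
      have hx2 : Real.sqrt (-1 / β n) ^ 2 = -1 / β n := Real.sq_sqrt hq.le
      refine ⟨⟨Real.sqrt_pos.2 hq, ?_⟩, ?_⟩
      · rw [Real.sqrt_lt' hu, div_lt_iff_of_neg hβneg]
        linarith
      · apply h.eq_zero_of_factor (n := n)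
        rw [hfacR, hx2]
        have hβ0 : β n ≠ 0 := hβneg.ne
        field_simp
        ring
  rw [key, Set.InjOn.ncard_image ?_, Set.ncard_coe_finset]
  -- injectivity from simplicity of the zeros
  intro n hn m hm hnm
  rw [Finset.mem_coe, hF] at hn hm
  have hβn : β n < 0 := by nlinarith [sq_nonneg u]
  have hβm : β m < 0 := by nlinarith [sq_nonneg u]
  set x : ℝ := Real.sqrt (-1 / β n) with hxdef
  have hqn : 0 < -1 / β n := div_pos_of_neg_of_neg (by norm_num) hβn
  have hqm : 0 < -1 / β m := div_pos_of_neg_of_neg (by norm_num) hβm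
  have hxn : x ^ 2 = -1 / β n := Real.sq_sqrt hqn.le
  have hnm' : Real.sqrt (-1 / β n) = Real.sqrt (-1 / β m) := by simpa using hnm
  have hxm : x ^ 2 = -1 / β m := by rw [hxdef, hnm']; exact Real.sq_sqrt hqm.le
  have hβn0 : β n ≠ 0 := hβn.ne
  have hβm0 : β m ≠ 0 := hβm.ne
  have hfn : 1 + (β n : ℂ) * (x : ℂ) ^ 2 = 0 := by rw [hfacR, hxn]; field_simp; ring
  have hfm : 1 + (β m : ℂ) * (x : ℂ) ^ 2 = 0 := by rw [hfacR, hxm]; field_simp; ring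
  have hx : deBruijnH t x = 0 := h.eq_zero_of_factor hfn
  -- the analytic order at `x` is `1`
  have hord : analyticOrderAt (deBruijnH t) (x : ℂ) = 1 := by
    have han : AnalyticAt ℂ (deBruijnH t) (x : ℂ) := (differentiable_deBruijnH_holds t).analyticAt _
    have := han.analyticOrderAt_sub_eq_one_of_deriv_ne_zero (hsimple x hx)
    simpa [hx] using this
  rw [h.analyticOrderAt_eq_mult hx] at hord
  have hmult : h.mult (x : ℂ) = 1 := by exact_mod_cast hord
  have hcard : (h.zeroIndices (x : ℂ)).card ≤ 1 := by
    change h.mult (x : ℂ) ≤ 1; rw [hmult]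
  exact Finset.card_le_one.1 hcard n ((IsHadamardSeq.mem_zeroIndices h).2 hfn) m
    ((IsHadamardSeq.mem_zeroIndices h).2 hfm)

/-- `N_t([0, T]) = N_t((0, T))` when `T` is not a zero (`0` never is). [folklore] -/
private theorem ncard_zeros_Icc_eq_Ioo {T : ℝ} (hT : deBruijnH t T ≠ 0) :
    deBruijnZeroCount t (Icc 0 T) = {x : ℝ | x ∈ Ioo 0 T ∧ deBruijnH t x = 0}.ncard := by
  rw [deBruijnZeroCount_eq]
  congr 1
  ext x
  simp only [Set.mem_setOf_eq, Set.mem_Icc, Set.mem_Ioo]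
  constructor
  · rintro ⟨⟨h0, h1⟩, hx⟩
    refine ⟨⟨lt_of_le_of_ne h0 ?_, lt_of_le_of_ne h1 ?_⟩, hx⟩
    · rintro rfl; exact deBruijnH_apply_zero_ne_zero t (by simpa using hx)
    · rintro rfl; exact hT hx
  · rintro ⟨⟨h0, h1⟩, hx⟩
    exact ⟨⟨h0.le, h1.le⟩, hx⟩

end HadamardLog


/-! ## E. Path integrals of `H_t'/H_t`: the curve `Γ_I` and the vertical segments -/

section Paths

variable {t : ℝ} {β : ℕ → ℝ}

/-- `log₊′(x) = 1/(2 + x)` for `x > 0` (`log₊ x := log(2 + |x|)`). [cite: RodgersTaoFMP2020, §1.2 p.6 («log₊(x) := log(2 + |x|)»)] -/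
theorem hasDerivAt_logPlus {x : ℝ} (hx : 0 < x) : HasDerivAt logPlus (1 / (2 + x)) x := by
  have h1 : HasDerivAt (fun y : ℝ ↦ Real.log (2 + y)) (1 / (2 + x)) x := by
    have := ((hasDerivAt_id x).const_add 2).log (by positivity)
    simpa using this
  refine h1.congr_of_eventuallyEq ?_
  filter_upwards [lt_mem_nhds hx] with y hy
  rw [logPlus_eq, abs_of_pos hy]

/-- The velocity of the curve `Γ_I : x ↦ x − iκ log₊ x` is `1 − iκ/(2 + x)` (`x > 0`).
[cite: RodgersTaoFMP2020, §3 proof of (48) p.24] -/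
theorem hasDerivAt_rodgersTaoZ {x : ℝ} (hx : 0 < x) (κ : ℝ) :
    HasDerivAt (fun y : ℝ ↦ rodgersTaoZ y κ) (1 - I * ((κ / (2 + x) : ℝ) : ℂ)) x := by
  have h1 : HasDerivAt (fun y : ℝ ↦ ((y : ℝ) : ℂ)) 1 x := by
    simpa using (hasDerivAt_id x).ofReal_comp
  have h2 : HasDerivAt (fun y : ℝ ↦ (((κ * logPlus y : ℝ)) : ℂ)) (((κ * (1 / (2 + x)) : ℝ) : ℂ)) x :=
    ((hasDerivAt_logPlus hx).const_mul κ).ofReal_comp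
  have h3 := h1.sub (h2.const_mul I)
  have e : ((κ * (1 / (2 + x)) : ℝ) : ℂ) = ((κ / (2 + x) : ℝ) : ℂ) := by
    rw [mul_one_div]
  rw [e] at h3
  exact h3

/-- Points of `Γ_I` with `x > 0`, `κ > 0` lie in the open lower half-plane. [folklore] -/
private theorem rodgersTaoZ_im_neg {x κ : ℝ} (hκ : 0 < κ) : (rodgersTaoZ x κ).im < 0 := by
  rw [rodgersTaoZ_im]
  exact neg_neg_of_pos (mul_pos hκ (logPlus_pos x))

/-- `H_t ≠ 0` on the open lower half-plane when all zeros are real. [folklore] -/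
private theorem deBruijnH_ne_zero_of_im_neg (hreal : HasOnlyRealZeros (deBruijnH t)) {w : ℂ}
    (hw : w.im < 0) : deBruijnH t w ≠ 0 := fun h0 ↦ (hreal w h0 ▸ hw).false

/-- `H_t'` is continuous (indeed entire). [folklore] -/
private theorem continuous_deriv_deBruijnH (t : ℝ) : Continuous (deriv (deBruijnH t)) :=
  (show Differentiable ℂ (deriv (deBruijnH t)) from
    fun w ↦ (((differentiable_deBruijnH_holds t).analyticAt w).deriv).differentiableAt).continuous

/-- The curve `Γ_I` is continuous. [folklore] -/
private theorem continuous_rodgersTaoZ (κ : ℝ) : Continuous fun x : ℝ ↦ rodgersTaoZ x κ := by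
  unfold rodgersTaoZ
  have : Continuous logPlus := by
    have e : logPlus = fun x ↦ Real.log (2 + |x|) := funext logPlus_eq
    rw [e]
    exact Continuous.log (by fun_prop) fun x ↦ by positivity
  fun_prop

/-- **FTC along `Γ_I`**: for `0 < a ≤ b`,
`∫_a^b (H_t'/H_t)(γ(x)) γ'(x) dx = L(γ(b)) − L(γ(a))`, `γ(x) = x − iκ log₊ x`.
[cite: RodgersTaoFMP2020, §3 proof of (48) p.24] -/
theorem integral_logDeriv_curve (h : IsHadamardSeq t (fun n ↦ (β n : ℂ))) (hβ : ∀ n, β n ≤ 0)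
    (hreal : HasOnlyRealZeros (deBruijnH t)) {κ a b : ℝ} (hκ : 0 < κ) (ha : 0 < a) (hab : a ≤ b) :
    ∫ x in a..b, deriv (deBruijnH t) (rodgersTaoZ x κ) / deBruijnH t (rodgersTaoZ x κ) *
        (1 - I * ((κ / (2 + x) : ℝ) : ℂ)) =
      (∑' n, Complex.log (1 + (β n : ℂ) * rodgersTaoZ b κ ^ 2)) -
        ∑' n, Complex.log (1 + (β n : ℂ) * rodgersTaoZ a κ ^ 2) := by
  set L : ℂ → ℂ := fun w ↦ ∑' n, Complex.log (1 + (β n : ℂ) * w ^ 2) with hL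
  have hderiv : ∀ x ∈ uIcc a b, HasDerivAt (fun y : ℝ ↦ L (rodgersTaoZ y κ))
      (deriv (deBruijnH t) (rodgersTaoZ x κ) / deBruijnH t (rodgersTaoZ x κ) *
        (1 - I * ((κ / (2 + x) : ℝ) : ℂ))) x := by
    intro x hx
    rw [uIcc_of_le hab] at hx
    have hx0 : 0 < x := ha.trans_le hx.1
    exact (hasDerivAt_tsum_log h hβ hreal (rodgersTaoZ_im_neg hκ)).comp x
      (hasDerivAt_rodgersTaoZ hx0 κ)
  have hcont : ContinuousOn (fun x : ℝ ↦
      deriv (deBruijnH t) (rodgersTaoZ x κ) / deBruijnH t (rodgersTaoZ x κ) *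
        (1 - I * ((κ / (2 + x) : ℝ) : ℂ))) (uIcc a b) := by
    rw [uIcc_of_le hab]
    refine ContinuousOn.mul (ContinuousOn.div ?_ ?_ fun x hx ↦ ?_) ?_
    · exact ((continuous_deriv_deBruijnH t).comp (continuous_rodgersTaoZ κ)).continuousOn
    · exact (((differentiable_deBruijnH_holds t).continuous).comp
        (continuous_rodgersTaoZ κ)).continuousOn
    · exact deBruijnH_ne_zero_of_im_neg hreal (rodgersTaoZ_im_neg hκ)
    · have h2x : ∀ x ∈ Icc a b, (2 : ℝ) + x ≠ 0 := fun x hx ↦ by linarith [hx.1]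
      have hq : ContinuousOn (fun x : ℝ ↦ κ / (2 + x)) (Icc a b) :=
        continuousOn_const.div (by fun_prop) h2x
      exact continuousOn_const.sub (continuousOn_const.mul
        (Complex.continuous_ofReal.comp_continuousOn hq))
  exact intervalIntegral.integral_eq_sub_of_hasDerivAt hderiv (hcont.intervalIntegrable)

/-- The downward vertical path `s ↦ T − is` has velocity `−i`. [folklore] -/
private theorem hasDerivAt_vertical (T : ℝ) (s : ℝ) :
    HasDerivAt (fun s : ℝ ↦ (T : ℂ) - I * (s : ℂ)) (-I) s := by
  have h1 : HasDerivAt (fun s : ℝ ↦ I * ((s : ℝ) : ℂ)) (I * 1) s :=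
    ((hasDerivAt_id s).ofReal_comp).const_mul I
  have h2 : HasDerivAt (fun s : ℝ ↦ (T : ℂ) - I * (s : ℂ)) (0 - I * 1) s :=
    (hasDerivAt_const s (T : ℂ)).sub h1
  simpa using h2

/-- For `s > 0` the point `T − is` lies in the open lower half-plane. [folklore] -/
private theorem vertical_im_neg (T : ℝ) {s : ℝ} (hs : 0 < s) : ((T : ℂ) - I * (s : ℂ)).im < 0 := by
  simp; linarith

/-- **FTC along the vertical segment** from the real point `T > 0` (not a zero) down to
`T − iS`: `∫_0^S (H_t'/H_t)(T − is)(−i) ds = L(T − iS) − L(T)`, using the continuity of `L` at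
`T` from the lower half-plane. [cite: RodgersTaoFMP2020, §3 proof of (48) p.24] -/
theorem integral_logDeriv_vertical (h : IsHadamardSeq t (fun n ↦ (β n : ℂ)))
    (hβ : ∀ n, β n ≤ 0) (hreal : HasOnlyRealZeros (deBruijnH t)) {T S : ℝ} (hT : 0 < T)
    (hHT : deBruijnH t T ≠ 0) (hS : 0 ≤ S) :
    ∫ s in (0 : ℝ)..S, deriv (deBruijnH t) ((T : ℂ) - I * (s : ℂ)) /
        deBruijnH t ((T : ℂ) - I * (s : ℂ)) * (-I) =
      (∑' n, Complex.log (1 + (β n : ℂ) * ((T : ℂ) - I * (S : ℂ)) ^ 2)) -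
        ∑' n, Complex.log (1 + (β n : ℂ) * (T : ℂ) ^ 2) := by
  set L : ℂ → ℂ := fun w ↦ ∑' n, Complex.log (1 + (β n : ℂ) * w ^ 2) with hL
  have hne : ∀ s ∈ Icc (0 : ℝ) S, deBruijnH t ((T : ℂ) - I * (s : ℂ)) ≠ 0 := by
    intro s hs
    rcases hs.1.eq_or_lt with h0 | h0
    · rw [← h0]; simpa using hHT
    · exact deBruijnH_ne_zero_of_im_neg hreal (vertical_im_neg T h0)
  have hderiv : ∀ s ∈ Ioo (0 : ℝ) S, HasDerivAt (fun s : ℝ ↦ L ((T : ℂ) - I * (s : ℂ)))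
      (deriv (deBruijnH t) ((T : ℂ) - I * (s : ℂ)) / deBruijnH t ((T : ℂ) - I * (s : ℂ)) *
        (-I)) s := by
    intro s hs
    exact (hasDerivAt_tsum_log h hβ hreal (vertical_im_neg T hs.1)).comp s
      (hasDerivAt_vertical T s)
  have hcont : ContinuousOn (fun s : ℝ ↦ L ((T : ℂ) - I * (s : ℂ))) (Icc 0 S) := by
    intro s hs
    rcases hs.1.eq_or_lt with h0 | hs0
    · -- the end point on the real axis
      subst h0
      have hc : ContinuousWithinAt L (insert (T : ℂ) {w : ℂ | w.im < 0}) (T : ℂ) :=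
        continuousWithinAt_insert_self.2 (continuousWithinAt_tsum_log h hβ hT hHT)
      have hmaps : MapsTo (fun s : ℝ ↦ (T : ℂ) - I * (s : ℂ)) (Icc 0 S)
          (insert (T : ℂ) {w : ℂ | w.im < 0}) := by
        intro s hs
        rcases hs.1.eq_or_lt with h0 | h0
        · left; rw [← h0]; simp
        · right; exact vertical_im_neg T h0
      exact hc.comp_of_eq (hasDerivAt_vertical T 0).continuousAt.continuousWithinAt hmaps
        (by simp)
    · exact ((hasDerivAt_tsum_log h hβ hreal (vertical_im_neg T hs0)).comp s
        (hasDerivAt_vertical T s)).continuousAt.continuousWithinAt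
  have hint : IntervalIntegrable (fun s : ℝ ↦
      deriv (deBruijnH t) ((T : ℂ) - I * (s : ℂ)) / deBruijnH t ((T : ℂ) - I * (s : ℂ)) *
        (-I)) volume 0 S := by
    refine (ContinuousOn.mul (ContinuousOn.div ?_ ?_ ?_) continuousOn_const).intervalIntegrable
    · exact ((continuous_deriv_deBruijnH t).comp (by fun_prop)).continuousOn
    · exact (((differentiable_deBruijnH_holds t).continuous).comp (by fun_prop)).continuousOn
    · rw [uIcc_of_le hS]; exact hne
  have := intervalIntegral.integral_eq_sub_of_hasDerivAt_of_le hS hcont hderiv hint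
  rw [this, hL]
  simp

end Paths

/-! ## F. Analytic estimates: the symmetries of `|H_t|`, and Backlund's lemma on the vertical
segments -/

section Estimates

variable {t : ℝ} {β : ℕ → ℝ}

/-- `log₊(2x) ≤ 2 log₊ x` for `x ≥ 0` (`2 + 2x ≤ (2 + x)²`). [folklore] -/
private theorem logPlus_two_mul_le {x : ℝ} (hx : 0 ≤ x) : logPlus (2 * x) ≤ 2 * logPlus x := by
  rw [logPlus_eq, logPlus_eq, abs_of_nonneg hx, abs_of_nonneg (by positivity : (0 : ℝ) ≤ 2 * x),
    ← Real.log_rpow (by positivity), Real.log_le_log_iff (by positivity) (by positivity)]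
  have : (2 + x) ^ (2 : ℝ) = (2 + x) ^ (2 : ℕ) := by norm_cast
  rw [this]; nlinarith

/-- `|H_t|` is even in `Re z` and in `Im z`: `‖H_t(z)‖ = ‖H_t(|Re z| − i|Im z|)‖`, and the latter
point is `rodgersTaoZ |Re z| κ'` with `κ' = |Im z|/log₊|Re z|`. [cite: RodgersTaoFMP2020, §3 proof of (48) p.24 («Using the symmetry `H_t(z̄) = conj H_t(z)`»; `H_t` is even)] -/
theorem norm_deBruijnH_eq_norm_rodgersTaoZ (t : ℝ) (z : ℂ) :
    ‖deBruijnH t z‖ = ‖deBruijnH t (rodgersTaoZ |z.re| (|z.im| / logPlus |z.re|))‖ := by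
  have hq : rodgersTaoZ |z.re| (|z.im| / logPlus |z.re|) =
      ((|z.re| : ℝ) : ℂ) - I * ((|z.im| : ℝ) : ℂ) := by
    rw [rodgersTaoZ, div_mul_cancel₀ _ (logPlus_pos _).ne']
  rw [hq]
  set q : ℂ := ((|z.re| : ℝ) : ℂ) - I * ((|z.im| : ℝ) : ℂ) with hqdef
  have hqre : q.re = |z.re| := by simp [hqdef]
  have hqim : q.im = -|z.im| := by simp [hqdef]
  rcases le_or_gt 0 z.re with hx | hx <;> rcases le_or_gt z.im 0 with hy | hy
  · have : q = z := Complex.ext (by rw [hqre, abs_of_nonneg hx]) (by rw [hqim, abs_of_nonpos hy]; ring)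
    rw [this]
  · have : q = starRingEnd ℂ z :=
      Complex.ext (by rw [hqre, abs_of_nonneg hx]; simp) (by rw [hqim, abs_of_pos hy]; simp)
    rw [this, deBruijnH_conj, Complex.norm_conj]
  · have : q = starRingEnd ℂ (-z) :=
      Complex.ext (by rw [hqre, abs_of_neg hx]; simp) (by rw [hqim, abs_of_nonpos hy]; simp)
    rw [this, deBruijnH_conj, Complex.norm_conj, deBruijnH_neg]
  · have : q = -z :=
      Complex.ext (by rw [hqre, abs_of_neg hx]; simp) (by rw [hqim, abs_of_pos hy]; simp)
    rw [this, deBruijnH_neg]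

/-- The (7)-type majorant transported to an arbitrary point: if `‖H_t(x' − iκ' log₊ x')‖ ≤
exp(−πx'/8 + A log₊² x')` for `x' ≥ 0`, `0 ≤ κ' ≤ C₇`, then for every `z` with
`|Im z| ≤ C₇ log₊ |Re z|`, `‖H_t(z)‖ ≤ exp(−π|Re z|/8 + A log₊² |Re z|)`.
[cite: RodgersTaoFMP2020, Lemma 2.1 (7) (FMP Lemma 4 p.8)] -/
theorem norm_deBruijnH_le_of_bound {C₇ A : ℝ}
    (h7 : ∀ x : ℝ, 0 ≤ x → ∀ κ' ∈ Icc 0 C₇,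
      ‖deBruijnH t (rodgersTaoZ x κ')‖ ≤ Real.exp (-(π * x / 8) + A * logPlus x ^ 2))
    {z : ℂ} (hz : |z.im| ≤ C₇ * logPlus |z.re|) :
    ‖deBruijnH t z‖ ≤ Real.exp (-(π * |z.re| / 8) + A * logPlus |z.re| ^ 2) := by
  rw [norm_deBruijnH_eq_norm_rodgersTaoZ]
  refine h7 _ (abs_nonneg _) _ ⟨div_nonneg (abs_nonneg _) (logPlus_pos _).le, ?_⟩
  rwa [div_le_iff₀ (logPlus_pos _)]

/-- `log₊` is monotone on `[0, ∞)`. [folklore] -/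
private theorem logPlus_le_logPlus_of_le {x y : ℝ} (hx : 0 ≤ x) (hxy : x ≤ y) : logPlus x ≤ logPlus y :=
  logPlus_mono (by rw [abs_of_nonneg hx, abs_of_nonneg (hx.trans hxy)]; exact hxy)

/-- The rotated function `g(w) = c · H_t(u − iw)` has derivative `c · H_t'(u − iw) · (−i)`.
[folklore] -/
private theorem hasDerivAt_rot (t : ℝ) (c : ℂ) (u : ℝ) (w : ℂ) :
    HasDerivAt (fun w : ℂ ↦ c * deBruijnH t ((u : ℂ) - I * w))
      (c * (deriv (deBruijnH t) ((u : ℂ) - I * w) * (-I))) w := by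
  have h1 : HasDerivAt (fun w : ℂ ↦ (u : ℂ) - I * w) (-I) w := by
    simpa using ((hasDerivAt_id w).const_mul I).const_sub (u : ℂ)
  have h2 : HasDerivAt (deBruijnH t) (deriv (deBruijnH t) ((u : ℂ) - I * w)) ((u : ℂ) - I * w) :=
    ((differentiable_deBruijnH_holds t) _).hasDerivAt
  exact (h2.comp w h1).const_mul c

/-- **Backlund's lemma on the vertical segment** from `u` down to `u − iκ log₊ u` (`u` real, not
a zero, `u ≥ 4κ log₊ u`): with the (7)-majorant (for `0 ≤ κ' ≤ C₇`, `C₇ ≥ 6κ`) and the (8)-lower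
bound at `u`, Jensen's formula on the discs of radii `κ log₊ u`, `2κ log₊ u` about `u − iκ log₊ u`
(for the rotated function `g(s) = e^{πu/8} H_t(u − is)`, `M ≪ e^{πκ log₊ u/4 + O(log₊² u)}`,
`g(κ log₊ u) = e^{O(log₊² u)}`) gives
`|arg H_t(u − iκ log₊ u) − arg H_t(u)| ≤ π (πκ log₊ u/4 + (4A₇ + A₈) log₊² u)/log 2`.
[cite: RodgersTaoFMP2020, §3 proof of (48) p.25 («m′ ≪ log²₊ T» by the Jensen formula)] -/
theorem abs_im_vertical_le (h : IsHadamardSeq t (fun n ↦ (β n : ℂ))) (hβ : ∀ n, β n ≤ 0)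
    (hreal : HasOnlyRealZeros (deBruijnH t)) {u κ C₇ A₇ A₈ : ℝ} (hκ : 0 < κ) (hA₇ : 0 ≤ A₇)
    (hC₇ : 6 * κ ≤ C₇)
    (h7 : ∀ x : ℝ, 0 ≤ x → ∀ κ' ∈ Icc 0 C₇,
      ‖deBruijnH t (rodgersTaoZ x κ')‖ ≤ Real.exp (-(π * x / 8) + A₇ * logPlus x ^ 2))
    (h8u : Real.exp (-(π * u / 8) - A₈ * logPlus u ^ 2) ≤ ‖deBruijnH t (rodgersTaoZ u κ)‖)
    (hu4 : 4 * (κ * logPlus u) ≤ u) (hHu : deBruijnH t u ≠ 0) :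
    |((∑' n, Complex.log (1 + (β n : ℂ) * rodgersTaoZ u κ ^ 2)) -
        ∑' n, Complex.log (1 + (β n : ℂ) * (u : ℂ) ^ 2)).im| ≤
      π * (π * (κ * logPlus u) / 4 + (4 * A₇ + A₈) * logPlus u ^ 2) / Real.log 2 := by
  set S : ℝ := κ * logPlus u with hS
  have hLpos : 0 < logPlus u := logPlus_pos u
  have hS0 : 0 < S := mul_pos hκ hLpos
  have hu0 : 0 < u := by linarith
  set c : ℝ := Real.exp (π * u / 8) with hc
  have hc0 : 0 < c := Real.exp_pos _
  set g : ℂ → ℂ := fun w ↦ (c : ℂ) * deBruijnH t ((u : ℂ) - I * w) with hg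
  set M : ℝ := Real.exp (π * S / 4 + 4 * A₇ * logPlus u ^ 2) with hM
  have hM1 : 1 ≤ M := Real.one_le_exp (by positivity)
  -- analyticity
  have hgan : ∀ z ∈ closedBall ((S : ℂ) + (0 : ℝ) * I) (2 * S), AnalyticAt ℂ g z := fun z _ ↦
    (show Differentiable ℂ g from fun w ↦ (hasDerivAt_rot t c u w).differentiableAt).analyticAt z
  -- the majorant on the disc
  have hgM : ∀ z ∈ closedBall ((S : ℂ) + (0 : ℝ) * I) (2 * S), ‖g z‖ ≤ M := by
    intro z hz
    have hz' : ‖z - (S : ℂ)‖ ≤ 2 * S := by simpa [dist_eq_norm] using hz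
    have hzim : |z.im| ≤ 2 * S := by
      have := abs_im_le_norm (z - (S : ℂ)); simp at this; linarith
    have hzre : |z.re - S| ≤ 2 * S := by
      have := abs_re_le_norm (z - (S : ℂ)); simp at this; linarith
    set p : ℂ := (u : ℂ) - I * z with hp
    have hpre : p.re = u + z.im := by simp [hp]
    have hpim : p.im = -z.re := by simp [hp]
    have hpre_lo : u - 2 * S ≤ p.re := by rw [hpre]; linarith [(abs_le.1 hzim).1]
    have hpre_hi : p.re ≤ u + 2 * S := by rw [hpre]; linarith [(abs_le.1 hzim).2]
    have hpre_pos : 0 < p.re := by linarith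
    have hapre : |p.re| = p.re := abs_of_pos hpre_pos
    have hapim : |p.im| ≤ 3 * S := by
      rw [hpim, abs_neg]
      have := abs_le.1 hzre
      rw [abs_le]; constructor <;> linarith
    -- `log₊ u ≤ 2 log₊ (p.re)` and `log₊ (p.re) ≤ 2 log₊ u`
    have hL1 : logPlus u ≤ 2 * logPlus p.re := by
      have h1 : logPlus u ≤ 2 * logPlus (u / 2) := by
        have := logPlus_two_mul_le (x := u / 2) (by positivity)
        rwa [show 2 * (u / 2) = u by ring] at this
      have h2 : logPlus (u / 2) ≤ logPlus p.re :=
        logPlus_le_logPlus_of_le (by positivity) (by linarith)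
      linarith
    have hL2 : logPlus p.re ≤ 2 * logPlus u := by
      have h1 : logPlus p.re ≤ logPlus (2 * u) :=
        logPlus_le_logPlus_of_le hpre_pos.le (by linarith)
      linarith [logPlus_two_mul_le hu0.le]
    have hcond : |p.im| ≤ C₇ * logPlus |p.re| := by
      rw [hapre]
      calc |p.im| ≤ 3 * S := hapim
        _ = 3 * κ * logPlus u := by rw [hS]; ring
        _ ≤ 3 * κ * (2 * logPlus p.re) := by gcongr
        _ = 6 * κ * logPlus p.re := by ring
        _ ≤ C₇ * logPlus p.re := mul_le_mul_of_nonneg_right hC₇ (logPlus_pos _).le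
    have hHp := norm_deBruijnH_le_of_bound h7 hcond
    rw [hapre] at hHp
    have hexp : -(π * p.re / 8) + A₇ * logPlus p.re ^ 2 ≤
        -(π * (u - 2 * S) / 8) + 4 * A₇ * logPlus u ^ 2 := by
      have h1 : -(π * p.re / 8) ≤ -(π * (u - 2 * S) / 8) := by
        have := Real.pi_pos; nlinarith
      have h2 : A₇ * logPlus p.re ^ 2 ≤ A₇ * (2 * logPlus u) ^ 2 := by
        gcongr
        exact (logPlus_pos _).le
      nlinarith
    calc ‖g z‖ = c * ‖deBruijnH t p‖ := by
          rw [hg]; simp only [norm_mul, Complex.norm_real, Real.norm_eq_abs, abs_of_pos hc0, hp]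
      _ ≤ c * Real.exp (-(π * (u - 2 * S) / 8) + 4 * A₇ * logPlus u ^ 2) :=
          mul_le_mul_of_nonneg_left (hHp.trans (Real.exp_le_exp.2 hexp)) hc0.le
      _ = M := by
          rw [hc, hM, ← Real.exp_add]; congr 1; ring
  -- the centre value
  have hcentre : g ((S : ℂ) + (0 : ℝ) * I) = (c : ℂ) * deBruijnH t (rodgersTaoZ u κ) := by
    simp [hg, rodgersTaoZ, hS]
  have hglow : Real.exp (-(A₈ * logPlus u ^ 2)) ≤ ‖g ((S : ℂ) + (0 : ℝ) * I)‖ := by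
    rw [hcentre, norm_mul, Complex.norm_real, Real.norm_eq_abs, abs_of_pos hc0]
    calc Real.exp (-(A₈ * logPlus u ^ 2)) = c * Real.exp (-(π * u / 8) - A₈ * logPlus u ^ 2) := by
          rw [hc, ← Real.exp_add]; congr 1; ring
      _ ≤ c * ‖deBruijnH t (rodgersTaoZ u κ)‖ := mul_le_mul_of_nonneg_left h8u hc0.le
  have hgc : g ((S : ℂ) + (0 : ℝ) * I) ≠ 0 :=
    norm_pos_iff.1 ((Real.exp_pos _).trans_le hglow)
  -- non-vanishing on the segment
  have hseg : ∀ x ∈ Icc (0 : ℝ) S, g ((x : ℂ) + (0 : ℝ) * I) ≠ 0 := by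
    intro x hx
    have : deBruijnH t ((u : ℂ) - I * (x : ℂ)) ≠ 0 := by
      rcases hx.1.eq_or_lt with h0 | h0
      · rw [← h0]; simpa using hHu
      · exact deBruijnH_ne_zero_of_im_neg hreal (vertical_im_neg u h0)
    simpa [hg, hc0.ne'] using this
  -- Backlund's lemma
  have hB := Literature.Analysis.Complex.abs_im_integral_logDeriv_le_backlund' (g := g)
    (c := S) (y := 0) (r := S) (R := 2 * S) (M := M) (a := 0) (b := S) hS0 (by linarith) hM1
    hgan hgM hgc hS0.le (by linarith) (by linarith) hseg
  -- identify the integral with `L(u − iS) − L(u)`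
  have hint_eq : (∫ x : ℝ in (0 : ℝ)..S, deriv g ((x : ℂ) + (0 : ℝ) * I) / g ((x : ℂ) + (0 : ℝ) * I)) =
      ∫ x : ℝ in (0 : ℝ)..S, deriv (deBruijnH t) ((u : ℂ) - I * (x : ℂ)) /
        deBruijnH t ((u : ℂ) - I * (x : ℂ)) * (-I) := by
    refine intervalIntegral.integral_congr fun x _ ↦ ?_
    simp only [Complex.ofReal_zero, zero_mul, add_zero]
    rw [(hasDerivAt_rot t c u x).deriv, hg]
    have hc' : (c : ℂ) ≠ 0 := by exact_mod_cast hc0.ne'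
    by_cases hH : deBruijnH t ((u : ℂ) - I * (x : ℂ)) = 0
    · simp [hH]
    · field_simp
  rw [hint_eq, integral_logDeriv_vertical h hβ hreal hu0 hHu hS0.le] at hB
  -- numerics
  have hlog2 : Real.log (2 * S / S) = Real.log 2 := by
    rw [mul_div_assoc, div_self hS0.ne', mul_one]
  rw [hlog2] at hB
  have hratio : M / ‖g ((S : ℂ) + (0 : ℝ) * I)‖ ≤
      Real.exp (π * S / 4 + (4 * A₇ + A₈) * logPlus u ^ 2) := by
    have hgpos : 0 < ‖g ((S : ℂ) + (0 : ℝ) * I)‖ := (Real.exp_pos _).trans_le hglow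
    rw [div_le_iff₀ hgpos]
    calc M = Real.exp (π * S / 4 + (4 * A₇ + A₈) * logPlus u ^ 2) * Real.exp (-(A₈ * logPlus u ^ 2)) := by
          rw [hM, ← Real.exp_add]; congr 1; ring
      _ ≤ _ := mul_le_mul_of_nonneg_left hglow (Real.exp_pos _).le
  have hlogle : Real.log (M / ‖g ((S : ℂ) + (0 : ℝ) * I)‖) ≤
      π * S / 4 + (4 * A₇ + A₈) * logPlus u ^ 2 := by
    have hpos : 0 < M / ‖g ((S : ℂ) + (0 : ℝ) * I)‖ :=
      div_pos (by linarith) ((Real.exp_pos _).trans_le hglow)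
    calc Real.log (M / ‖g ((S : ℂ) + (0 : ℝ) * I)‖)
        ≤ Real.log (Real.exp (π * S / 4 + (4 * A₇ + A₈) * logPlus u ^ 2)) :=
          Real.log_le_log hpos hratio
      _ = _ := Real.log_exp _
  have hrz : rodgersTaoZ u κ = (u : ℂ) - I * (S : ℂ) := by simp [rodgersTaoZ, hS]
  rw [hrz]
  calc |((∑' n, Complex.log (1 + (β n : ℂ) * ((u : ℂ) - I * (S : ℂ)) ^ 2)) -
          ∑' n, Complex.log (1 + (β n : ℂ) * (u : ℂ) ^ 2)).im|
      ≤ π * Real.log (M / ‖g ((S : ℂ) + (0 : ℝ) * I)‖) / Real.log 2 := hB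
    _ ≤ π * (π * S / 4 + (4 * A₇ + A₈) * logPlus u ^ 2) / Real.log 2 := by
        gcongr
    _ = π * (π * (κ * logPlus u) / 4 + (4 * A₇ + A₈) * logPlus u ^ 2) / Real.log 2 := by
        rw [hS]

/-- `log₊ x ≤ x + 1` for `x ≥ 0` (`log y ≤ y − 1`). [folklore] -/
private theorem logPlus_le_add_one {x : ℝ} (hx : 0 ≤ x) : logPlus x ≤ x + 1 := by
  rw [logPlus_eq, abs_of_nonneg hx]
  have := Real.log_le_sub_one_of_pos (by positivity : (0 : ℝ) < 2 + x)
  linarith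

/-- **The small zeros** (Jensen's formula on one disc): with the (7)-majorant (`C₇ ≥ 6(1+κ)(X+1)`)
and the (8)-lower bound at `X`, the number of zeros of `H_t` in `(0, X + 1]` is bounded by a
constant depending only on `κ, X, A₇, A₈` — uniformly in `t`. (The printed proof starts the contour
at `x = 0` using (9) for all `x ≥ 0`; the typed (9) holds for `x ≥ C″` only, so the twin starts at
`X ≥ C″` and pays this `O(1)`.) [cite: RodgersTaoFMP2020, §3 proof of (48) p.25 (the Jensen formula)] -/
theorem ncard_small_zeros_mul_log_two_le {t X κ C₇ A₇ A₈ : ℝ} (hκ : 0 < κ) (hX : 0 < X)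
    (hA₇ : 0 ≤ A₇)
    (h7 : ∀ x : ℝ, 0 ≤ x → ∀ κ' ∈ Icc 0 C₇,
      ‖deBruijnH t (rodgersTaoZ x κ')‖ ≤ Real.exp (-(π * x / 8) + A₇ * logPlus x ^ 2))
    (hC₇ : 6 * (1 + κ) * (X + 1) ≤ C₇)
    (h8X : Real.exp (-(π * X / 8) - A₈ * logPlus X ^ 2) ≤ ‖deBruijnH t (rodgersTaoZ X κ)‖) :
    ({x : ℝ | x ∈ Ioc 0 (X + 1) ∧ deBruijnH t x = 0}.ncard : ℝ) * Real.log 2 ≤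
      A₇ * logPlus (X + 2 * (1 + κ) * (X + 1)) ^ 2 + π * X / 8 + A₈ * logPlus X ^ 2 := by
  set c : ℂ := rodgersTaoZ X κ with hcdef
  set R : ℝ := 2 * (1 + κ) * (X + 1) with hR
  have hR0 : 0 < R := by positivity
  have hcre : c.re = X := rodgersTaoZ_re X κ
  have hcim : c.im = -(κ * logPlus X) := rodgersTaoZ_im X κ
  have hκL : κ * logPlus X ≤ κ * (X + 1) := mul_le_mul_of_nonneg_left (logPlus_le_add_one hX.le) hκ.le
  -- the finite set of zeros
  set S : Set ℝ := {x : ℝ | x ∈ Ioc 0 (X + 1) ∧ deBruijnH t x = 0} with hSdef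
  have hSfin : S.Finite := (finite_real_zeros_deBruijnH_Icc t 0 (X + 1)).subset
    fun x hx ↦ ⟨⟨hx.1.1.le, hx.1.2⟩, hx.2⟩
  classical
  set F : Finset ℂ := hSfin.toFinset.image (fun x : ℝ ↦ (x : ℂ)) with hFdef
  have hFcard : F.card = S.ncard := by
    rw [hFdef, Finset.card_image_of_injective _ Complex.ofReal_injective,
      Set.ncard_eq_toFinset_card S hSfin]
  -- distances from the centre
  have hdist : ∀ u ∈ F, 0 < ‖u - c‖ ∧ ‖u - c‖ ≤ R / 2 ∧ deBruijnH t u = 0 := by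
    intro u hu
    rw [hFdef, Finset.mem_image] at hu
    obtain ⟨x, hx, rfl⟩ := hu
    rw [Set.Finite.mem_toFinset] at hx
    obtain ⟨⟨hx0, hx1⟩, hHx⟩ := hx
    refine ⟨?_, ?_, hHx⟩
    · rw [norm_pos_iff, sub_ne_zero]
      intro hxc
      have := congrArg Complex.im hxc
      rw [Complex.ofReal_im, hcim] at this
      have := mul_pos hκ (logPlus_pos X)
      linarith
    · have h1 : |((x : ℂ) - c).re| ≤ X + 1 := by
        simp only [sub_re, Complex.ofReal_re, hcre]
        rw [abs_le]; constructor <;> linarith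
      have h2 : |((x : ℂ) - c).im| ≤ κ * (X + 1) := by
        simp only [sub_im, Complex.ofReal_im, hcim]
        rw [zero_sub, neg_neg, abs_of_pos (mul_pos hκ (logPlus_pos X))]
        exact hκL
      have h3 : ‖(x : ℂ) - c‖ ≤ |((x : ℂ) - c).re| + |((x : ℂ) - c).im| :=
        Complex.norm_le_abs_re_add_abs_im _
      rw [hR]; linarith
  -- Jensen
  have han : AnalyticOnNhd ℂ (deBruijnH t) (closedBall c R) := fun z _ ↦
    (differentiable_deBruijnH_holds t).analyticAt z
  have hc0 : deBruijnH t c ≠ 0 :=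
    norm_pos_iff.1 ((Real.exp_pos _).trans_le h8X)
  have hJ := Literature.Analysis.Complex.sum_log_div_le_circleAverage_sub hR0 han hc0 F
    fun u hu ↦ ⟨by linarith [(hdist u hu).2.1], (hdist u hu).2.2⟩
  -- lower bound of the weighted sum: each weight is at least `log 2`
  have hlow : (F.card : ℝ) * Real.log 2 ≤ ∑ u ∈ F, Real.log (R / ‖u - c‖) := by
    have := Finset.card_nsmul_le_sum F (fun u ↦ Real.log (R / ‖u - c‖)) (Real.log 2)
      fun u hu ↦ by
        obtain ⟨hpos, hle, -⟩ := hdist u hu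
        exact Real.log_le_log two_pos (by rw [le_div_iff₀ hpos]; linarith)
    rwa [nsmul_eq_mul] at this
  -- upper bound of the circle average
  have hsph : ∀ z ∈ sphere c |R|, Real.log ‖deBruijnH t z‖ ≤ A₇ * logPlus (X + R) ^ 2 := by
    intro z hz
    rw [abs_of_pos hR0] at hz
    have hzc : ‖z - c‖ = R := by simpa [dist_eq_norm] using hz
    have hre : |z.re| ≤ X + R := by
      have h1 : |(z - c).re| ≤ R := hzc ▸ abs_re_le_norm (z - c)
      simp only [sub_re, hcre] at h1
      have := abs_sub_abs_le_abs_sub z.re X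
      rw [abs_of_pos hX] at this
      linarith
    have him : |z.im| ≤ 3 * R / 2 := by
      have h1 : |(z - c).im| ≤ R := hzc ▸ abs_im_le_norm (z - c)
      simp only [sub_im, hcim] at h1
      have := abs_sub_abs_le_abs_sub z.im (-(κ * logPlus X))
      rw [abs_neg, abs_of_pos (mul_pos hκ (logPlus_pos X))] at this
      rw [hR] at h1 ⊢; linarith
    have hcond : |z.im| ≤ C₇ * logPlus |z.re| := by
      have hl2 : Real.log 2 ≤ logPlus |z.re| := log_two_le_logPlus _
      have hlog2 : (1 : ℝ) / 2 < Real.log 2 := by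
        have := Real.log_two_gt_d9; linarith
      have hC₇0 : 0 ≤ C₇ := le_trans (by positivity) hC₇
      calc |z.im| ≤ 3 * R / 2 := him
        _ = 6 * (1 + κ) * (X + 1) * (1 / 2) := by rw [hR]; ring
        _ ≤ C₇ * (1 / 2) := by gcongr
        _ ≤ C₇ * logPlus |z.re| := by
            apply mul_le_mul_of_nonneg_left _ hC₇0; linarith
    have hHz := norm_deBruijnH_le_of_bound h7 hcond
    rcases eq_or_ne (deBruijnH t z) 0 with h0 | h0
    · rw [h0, norm_zero, Real.log_zero]
      exact mul_nonneg hA₇ (sq_nonneg _)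
    calc Real.log ‖deBruijnH t z‖
        ≤ Real.log (Real.exp (-(π * |z.re| / 8) + A₇ * logPlus |z.re| ^ 2)) :=
          Real.log_le_log (norm_pos_iff.2 h0) hHz
      _ = -(π * |z.re| / 8) + A₇ * logPlus |z.re| ^ 2 := Real.log_exp _
      _ ≤ A₇ * logPlus (X + R) ^ 2 := by
          have h1 : 0 ≤ π * |z.re| / 8 := by positivity
          have h2 : logPlus |z.re| ≤ logPlus (X + R) :=
            logPlus_le_logPlus_of_le (abs_nonneg _) hre
          have h3 : logPlus |z.re| ^ 2 ≤ logPlus (X + R) ^ 2 := by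
            gcongr; exact (logPlus_pos _).le
          nlinarith
  have hint : CircleIntegrable (fun z ↦ Real.log ‖deBruijnH t z‖) c R := by
    have h1 : AnalyticOnNhd ℂ (deBruijnH t) (sphere c |R|) := fun z _ ↦
      (differentiable_deBruijnH_holds t).analyticAt z
    exact h1.meromorphicOn.circleIntegrable_log_norm
  have havg := Real.circleAverage_mono_on_of_le_circle hint hsph
  -- the centre
  have hlogc : -(π * X / 8) - A₈ * logPlus X ^ 2 ≤ Real.log ‖deBruijnH t c‖ := by
    have := Real.log_le_log (Real.exp_pos _) h8X
    rwa [Real.log_exp] at this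
  rw [← hFcard]
  have : (X + 2 * (1 + κ) * (X + 1)) = X + R := by rw [hR]
  rw [this]
  linarith

end Estimates

/-! ## G. The main term along `Γ_I`: (9), the exact primitive `πΨ(iz)`, and the error integral -/

section MainTerm

variable {t : ℝ}

/-- The threshold for `4κ log₊ x ≤ x`: it holds once `x ≥ (8κ + 2)²` (`log y ≤ 2√y`). [folklore] -/
private theorem four_mul_logPlus_le {κ x : ℝ} (hκ : 0 < κ) (hx : (8 * κ + 2) ^ 2 ≤ x) :
    4 * (κ * logPlus x) ≤ x := by
  have hx0 : 0 ≤ x := le_trans (sq_nonneg _) hx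
  set u : ℝ := Real.sqrt (2 + x) with hu
  have hu0 : 0 < u := Real.sqrt_pos.2 (by linarith)
  have hu2 : u ^ 2 = 2 + x := Real.sq_sqrt (by linarith)
  have hul : 8 * κ + 2 ≤ u := by
    rw [hu, Real.le_sqrt (by positivity) (by linarith)]; linarith
  have hlog : logPlus x = 2 * Real.log u := by
    rw [logPlus_eq, abs_of_nonneg hx0, hu, Real.log_sqrt (by linarith)]; ring
  have hlogu : Real.log u ≤ u - 1 := Real.log_le_sub_one_of_pos hu0
  rw [hlog]
  nlinarith

/-- `iz` for `z = x − iκ log₊ x` is `κ log₊ x + ix`, a point of the open right half-plane.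
[folklore] -/
private theorem I_mul_rodgersTaoZ (x κ : ℝ) :
    I * rodgersTaoZ x κ = ((κ * logPlus x : ℝ) : ℂ) + I * (x : ℂ) := by
  rw [rodgersTaoZ]; ring_nf; rw [I_sq]; ring

/-- `Re(iz) = κ log₊ x > 0` for `κ > 0`. [folklore] -/
private theorem I_mul_rodgersTaoZ_re_pos {x κ : ℝ} (hκ : 0 < κ) : 0 < (I * rodgersTaoZ x κ).re := by
  rw [I_mul_rodgersTaoZ]; simp; exact mul_pos hκ (logPlus_pos x)

/-- The complex `Ψ(w) = (w/4π) log(w/4π) − w/4π` has derivative `log(w/4π)/4π` at every `w` with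
`w/4π` in the slit plane. [cite: RodgersTaoFMP2020, §3 eq. (39) p.20 («Ψ′(T) = (1/4π) log(T/4π)»)] -/
theorem hasDerivAt_psiC {w : ℂ} (hw : w / (4 * π) ∈ slitPlane) :
    HasDerivAt (fun w : ℂ ↦ w / (4 * π) * Complex.log (w / (4 * π)) - w / (4 * π))
      (Complex.log (w / (4 * π)) / (4 * π)) w := by
  have hπ : (4 * π : ℂ) ≠ 0 := by exact_mod_cast (by positivity : (4 * π : ℝ) ≠ 0)
  have hw0 : w ≠ 0 := by
    intro h0; rw [h0, zero_div] at hw; exact Complex.slitPlane_ne_zero hw rfl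
  have h1 : HasDerivAt (fun w : ℂ ↦ w / (4 * π)) (1 / (4 * π)) w := by
    simpa using (hasDerivAt_id w).div_const (4 * π : ℂ)
  have h2 : HasDerivAt (fun w : ℂ ↦ Complex.log (w / (4 * π))) ((1 / (4 * π)) / (w / (4 * π))) w :=
    h1.clog hw
  have h3 := (h1.fun_mul h2).sub h1
  have e : 1 / (4 * ↑π) * Complex.log (w / (4 * ↑π)) + w / (4 * ↑π) * (1 / (4 * ↑π) / (w / (4 * ↑π))) -
      1 / (4 * ↑π) = Complex.log (w / (4 * π)) / (4 * π) := by
    field_simp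
    ring
  rw [e] at h3
  exact h3

/-- **The exact primitive of the main term of (9) along `Γ_I`**:
`d/dx [π Ψ(iγ(x))] = (i/4) log(iγ(x)/4π) · γ′(x)` (`γ(x) = x − iκ log₊ x`, `x > 0`, `κ > 0`).
[cite: RodgersTaoFMP2020, §3 proof of (48) p.24 («(1/π)(H_t′/H_t)(z) = (d/dz)(Ψ(iz)) + O(log₊ x/x)»)] -/
theorem hasDerivAt_psiC_curve {x κ : ℝ} (hx : 0 < x) (hκ : 0 < κ) :
    HasDerivAt (fun y : ℝ ↦ (π : ℂ) * ((I * rodgersTaoZ y κ) / (4 * π) *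
        Complex.log ((I * rodgersTaoZ y κ) / (4 * π)) - (I * rodgersTaoZ y κ) / (4 * π)))
      (I / 4 * Complex.log (I * rodgersTaoZ x κ / (4 * π)) *
        (1 - I * ((κ / (2 + x) : ℝ) : ℂ))) x := by
  have hπ : (4 * π : ℂ) ≠ 0 := by exact_mod_cast (by positivity : (4 * π : ℝ) ≠ 0)
  have hsl : I * rodgersTaoZ x κ / (4 * π) ∈ slitPlane := by
    rw [mem_slitPlane_iff]; left
    have : (I * rodgersTaoZ x κ / (4 * π)).re = (I * rodgersTaoZ x κ).re / (4 * π) := by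
      have e : (4 * (π : ℂ)) = ((4 * π : ℝ) : ℂ) := by push_cast; ring
      rw [e, Complex.div_ofReal_re]
    rw [this]; exact div_pos (I_mul_rodgersTaoZ_re_pos hκ) (by positivity)
  have hγ : HasDerivAt (fun y : ℝ ↦ I * rodgersTaoZ y κ) (I * (1 - I * ((κ / (2 + x) : ℝ) : ℂ))) x :=
    (hasDerivAt_rodgersTaoZ hx κ).const_mul I
  have hΨ := (hasDerivAt_psiC hsl).comp x hγ
  have h := hΨ.const_mul (π : ℂ)
  have e : (π : ℂ) * (Complex.log (I * rodgersTaoZ x κ / (4 * π)) / (4 * π) *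
      (I * (1 - I * ((κ / (2 + x) : ℝ) : ℂ)))) =
      I / 4 * Complex.log (I * rodgersTaoZ x κ / (4 * π)) * (1 - I * ((κ / (2 + x) : ℝ) : ℂ)) := by
    field_simp
  rw [e] at h
  exact h

/-- The main-term integral along `Γ_I`: `∫_a^b (i/4) log(iγ/4π) γ′ = π[Ψ(iγ(b)) − Ψ(iγ(a))]`.
[cite: RodgersTaoFMP2020, §3 proof of (48) p.24 («by the fundamental theorem of calculus»)] -/
theorem integral_mainTerm_curve {κ a b : ℝ} (hκ : 0 < κ) (ha : 0 < a) (hab : a ≤ b) :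
    ∫ x in a..b, I / 4 * Complex.log (I * rodgersTaoZ x κ / (4 * π)) *
        (1 - I * ((κ / (2 + x) : ℝ) : ℂ)) =
      (π : ℂ) * ((I * rodgersTaoZ b κ) / (4 * π) * Complex.log ((I * rodgersTaoZ b κ) / (4 * π)) -
          (I * rodgersTaoZ b κ) / (4 * π)) -
      (π : ℂ) * ((I * rodgersTaoZ a κ) / (4 * π) * Complex.log ((I * rodgersTaoZ a κ) / (4 * π)) -
          (I * rodgersTaoZ a κ) / (4 * π)) := by
  have hsl : ∀ x : ℝ, I * rodgersTaoZ x κ / (4 * π) ∈ slitPlane := by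
    intro x
    rw [mem_slitPlane_iff]; left
    have : (I * rodgersTaoZ x κ / (4 * π)).re = (I * rodgersTaoZ x κ).re / (4 * π) := by
      have e : (4 * (π : ℂ)) = ((4 * π : ℝ) : ℂ) := by push_cast; ring
      rw [e, Complex.div_ofReal_re]
    rw [this]; exact div_pos (I_mul_rodgersTaoZ_re_pos hκ) (by positivity)
  have hderiv : ∀ x ∈ uIcc a b, HasDerivAt (fun y : ℝ ↦ (π : ℂ) * ((I * rodgersTaoZ y κ) / (4 * π) *
        Complex.log ((I * rodgersTaoZ y κ) / (4 * π)) - (I * rodgersTaoZ y κ) / (4 * π)))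
      (I / 4 * Complex.log (I * rodgersTaoZ x κ / (4 * π)) *
        (1 - I * ((κ / (2 + x) : ℝ) : ℂ))) x := by
    intro x hx
    rw [uIcc_of_le hab] at hx
    exact hasDerivAt_psiC_curve (ha.trans_le hx.1) hκ
  have hint : IntervalIntegrable (fun x : ℝ ↦ I / 4 * Complex.log (I * rodgersTaoZ x κ / (4 * π)) *
        (1 - I * ((κ / (2 + x) : ℝ) : ℂ))) volume a b := by
    refine ContinuousOn.intervalIntegrable ?_
    rw [uIcc_of_le hab]
    refine ContinuousOn.mul (ContinuousOn.mul continuousOn_const ?_) ?_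
    · refine ContinuousOn.clog ?_ fun x _ ↦ hsl x
      exact ((continuous_const.mul (continuous_rodgersTaoZ κ)).div_const _).continuousOn
    · have h2x : ∀ x ∈ Icc a b, (2 : ℝ) + x ≠ 0 := fun x hx ↦ by linarith [hx.1]
      have hq : ContinuousOn (fun x : ℝ ↦ κ / (2 + x)) (Icc a b) :=
        continuousOn_const.div (by fun_prop) h2x
      exact continuousOn_const.sub (continuousOn_const.mul
        (Complex.continuous_ofReal.comp_continuousOn hq))
  exact intervalIntegral.integral_eq_sub_of_hasDerivAt hderiv hint

/-- The velocity of `Γ_I` is bounded: `‖1 − iκ/(2+x)‖ ≤ 1 + κ` (`x ≥ 0`, `κ ≥ 0`). [folklore] -/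
private theorem norm_velocity_le {κ x : ℝ} (hκ : 0 ≤ κ) (hx : 0 ≤ x) :
    ‖(1 : ℂ) - I * ((κ / (2 + x) : ℝ) : ℂ)‖ ≤ 1 + κ := by
  calc ‖(1 : ℂ) - I * ((κ / (2 + x) : ℝ) : ℂ)‖ ≤ ‖(1 : ℂ)‖ + ‖I * ((κ / (2 + x) : ℝ) : ℂ)‖ :=
        norm_sub_le _ _
    _ = 1 + κ / (2 + x) := by
        rw [norm_one, norm_mul, Complex.norm_I, one_mul, Complex.norm_real, Real.norm_eq_abs,
          abs_of_nonneg (by positivity)]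
    _ ≤ 1 + κ := by
        gcongr
        exact div_le_self hκ (by linarith)

/-- `(log₊²)′(x) = 2 log₊ x/(2 + x)` for `x > 0`. [folklore] -/
private theorem hasDerivAt_logPlus_sq {x : ℝ} (hx : 0 < x) :
    HasDerivAt (fun y : ℝ ↦ logPlus y ^ 2) (2 * logPlus x / (2 + x)) x := by
  have h := (hasDerivAt_logPlus hx).mul (hasDerivAt_logPlus hx)
  have e1 : (fun y : ℝ ↦ logPlus y ^ 2) = (fun y ↦ logPlus y) * fun y ↦ logPlus y := by
    funext y; simp [sq]
  rw [e1]
  have e2 : 1 / (2 + x) * logPlus x + logPlus x * (1 / (2 + x)) = 2 * logPlus x / (2 + x) := by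
    ring
  rw [e2] at h
  exact h

/-- **The error integral**: if `‖E(x)‖ ≤ A log₊ x/x` on `[a, b]` (`2 ≤ a`), then
`‖∫_a^b E(x) γ′(x) dx‖ ≤ A(1+κ)(log₊² b − log₊² a)` (`log₊ x/x ≤ 2 log₊ x/(2+x) = (log₊²)′` for
`x ≥ 2`). [cite: RodgersTaoFMP2020, §3 proof of (48) p.24 (the `O(log²₊ T)` from `∫ log₊ x/x`)] -/
theorem norm_integral_error_le {E : ℝ → ℂ} {κ a b A : ℝ} (hκ : 0 ≤ κ) (ha : 2 ≤ a) (hab : a ≤ b)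
    (hE : ∀ x ∈ Icc a b, ‖E x‖ ≤ A * logPlus x / x) :
    ‖∫ x in a..b, E x * (1 - I * ((κ / (2 + x) : ℝ) : ℂ))‖ ≤
      A * (1 + κ) * (logPlus b ^ 2 - logPlus a ^ 2) := by
  have hA : 0 ≤ A := by
    have h := hE a ⟨le_rfl, hab⟩
    have ha0 : 0 < a := by linarith
    by_contra hA
    have : A * logPlus a / a < 0 :=
      div_neg_of_neg_of_pos (mul_neg_of_neg_of_pos (lt_of_not_ge hA) (logPlus_pos a)) ha0
    linarith [norm_nonneg (E a)]
  have hbound : ∀ x ∈ Icc a b, ‖E x * (1 - I * ((κ / (2 + x) : ℝ) : ℂ))‖ ≤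
      A * (1 + κ) * (2 * logPlus x / (2 + x)) := by
    intro x hx
    have hx0 : 0 < x := by linarith [hx.1]
    rw [norm_mul]
    have h1 := hE x hx
    have h2 := norm_velocity_le hκ hx0.le
    have h3 : A * logPlus x / x ≤ A * (2 * logPlus x / (2 + x)) := by
      rw [mul_div_assoc]
      refine mul_le_mul_of_nonneg_left ?_ hA
      rw [div_le_div_iff₀ hx0 (by linarith)]
      nlinarith [logPlus_pos x, hx.1]
    calc ‖E x‖ * ‖(1 : ℂ) - I * ((κ / (2 + x) : ℝ) : ℂ)‖
        ≤ (A * (2 * logPlus x / (2 + x))) * (1 + κ) :=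
          mul_le_mul (h1.trans h3) h2 (norm_nonneg _)
            (mul_nonneg hA (div_nonneg (by linarith [logPlus_pos x]) (by linarith)))
      _ = A * (1 + κ) * (2 * logPlus x / (2 + x)) := by ring
  have h2x : ∀ x ∈ Icc a b, (2 : ℝ) + x ≠ 0 := fun x hx ↦ by linarith [hx.1]
  have hcontg : ContinuousOn (fun x : ℝ ↦ A * (1 + κ) * (2 * logPlus x / (2 + x))) (Icc a b) := by
    have hl : Continuous logPlus := by
      have e : logPlus = fun x ↦ Real.log (2 + |x|) := funext logPlus_eq
      rw [e]; exact Continuous.log (by fun_prop) fun x ↦ by positivity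
    exact continuousOn_const.mul ((continuousOn_const.mul hl.continuousOn).div (by fun_prop) h2x)
  have hgi : IntervalIntegrable (fun x : ℝ ↦ A * (1 + κ) * (2 * logPlus x / (2 + x))) volume a b := by
    refine ContinuousOn.intervalIntegrable ?_
    rw [uIcc_of_le hab]; exact hcontg
  have hI := intervalIntegral.norm_integral_le_of_norm_le (μ := volume) hab
    (MeasureTheory.ae_of_all _ fun x hx ↦ hbound x ⟨hx.1.le, hx.2⟩) hgi
  have hFTC : ∫ x in a..b, A * (1 + κ) * (2 * logPlus x / (2 + x)) =
      A * (1 + κ) * (logPlus b ^ 2 - logPlus a ^ 2) := by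
    rw [intervalIntegral.integral_const_mul]
    congr 1
    refine intervalIntegral.integral_eq_sub_of_hasDerivAt (f := fun y : ℝ ↦ logPlus y ^ 2)
      (fun x hx ↦ ?_) ?_
    · rw [uIcc_of_le hab] at hx
      exact hasDerivAt_logPlus_sq (by linarith [hx.1])
    · refine ContinuousOn.intervalIntegrable ?_
      rw [uIcc_of_le hab]
      have hl : Continuous logPlus := by
        have e : logPlus = fun x ↦ Real.log (2 + |x|) := funext logPlus_eq
        rw [e]; exact Continuous.log (by fun_prop) fun x ↦ by positivity
      exact (continuousOn_const.mul hl.continuousOn).div (by fun_prop) h2x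
  rw [hFTC] at hI
  exact hI

/-- **`Im Ψ(iz) = Ψ(T) + O(log₊ T)` at `z = T − iκ log₊ T`**: with `w = iz = κ log₊ T + iT`,
`|Im Ψ_ℂ(w) − Ψ(T)| ≤ κ log₊ T` (`|arg w| ≤ π/2`, `0 ≤ log|w| − log T ≤ κ log₊ T/T`).
[cite: RodgersTaoFMP2020, §3 proof of (48) p.24 («Im Ψ(iT + κ log₊ T) − Ψ(log₊ 0) + O(log²₊ T) = Ψ(T) + O(log²₊ T)»)] -/
theorem abs_im_psiC_sub_psi_le {T κ : ℝ} (hT : 0 < T) (hκ : 0 ≤ κ) :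
    |((I * rodgersTaoZ T κ) / (4 * π) * Complex.log ((I * rodgersTaoZ T κ) / (4 * π)) -
        (I * rodgersTaoZ T κ) / (4 * π)).im - rodgersTaoPsi T| ≤ κ * logPlus T := by
  have hπ : 0 < 4 * π := by positivity
  set a : ℝ := κ * logPlus T with ha
  have ha0 : 0 ≤ a := mul_nonneg hκ (logPlus_pos T).le
  set q : ℂ := (I * rodgersTaoZ T κ) / (4 * π) with hq
  have hqeq : q = (((a / (4 * π) : ℝ)) : ℂ) + I * (((T / (4 * π) : ℝ)) : ℂ) := by
    rw [hq, I_mul_rodgersTaoZ, ← ha]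
    have e : (4 * (π : ℂ)) = ((4 * π : ℝ) : ℂ) := by push_cast; ring
    rw [e]; push_cast; field_simp
  have hqre : q.re = a / (4 * π) := by
    rw [hqeq]; simp only [add_re, ofReal_re, mul_re, I_re, I_im, ofReal_im]; ring
  have hqim : q.im = T / (4 * π) := by
    rw [hqeq]; simp only [add_im, ofReal_im, mul_im, I_re, I_im, ofReal_re]; ring
  have hqim0 : 0 < q.im := by rw [hqim]; positivity
  have hqre0 : 0 ≤ q.re := by rw [hqre]; positivity
  -- the imaginary part of `q log q − q`
  have him : (q * Complex.log q - q).im =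
      q.re * Complex.arg q + q.im * Real.log ‖q‖ - q.im := by
    rw [sub_im, mul_im, Complex.log_re, Complex.log_im]
  -- size of `‖q‖`
  have hn_lo : q.im ≤ ‖q‖ := le_trans (le_abs_self _) (abs_im_le_norm q)
  have hn_hi : ‖q‖ ≤ q.re + q.im := by
    have := norm_le_abs_re_add_abs_im q
    rwa [abs_of_nonneg hqre0, abs_of_pos hqim0] at this
  have hn0 : 0 < ‖q‖ := hqim0.trans_le hn_lo
  have hlog_lo : Real.log q.im ≤ Real.log ‖q‖ := Real.log_le_log hqim0 hn_lo
  have hlog_hi : Real.log ‖q‖ - Real.log q.im ≤ q.re / q.im := by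
    rw [← Real.log_div hn0.ne' hqim0.ne']
    have h1 : ‖q‖ / q.im ≤ 1 + q.re / q.im := by
      rw [div_le_iff₀ hqim0, add_mul, one_mul, div_mul_cancel₀ _ hqim0.ne']; linarith
    have h2 := Real.log_le_sub_one_of_pos (div_pos hn0 hqim0)
    linarith
  have harg : |Complex.arg q| ≤ π / 2 := Complex.abs_arg_le_pi_div_two_iff.2 hqre0
  -- assemble
  have hΨ : rodgersTaoPsi T = q.im * Real.log q.im - q.im := by
    rw [rodgersTaoPsi, hqim]
  rw [him, hΨ]
  have hkey : q.re * Complex.arg q + q.im * Real.log ‖q‖ - q.im - (q.im * Real.log q.im - q.im) =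
      q.re * Complex.arg q + q.im * (Real.log ‖q‖ - Real.log q.im) := by ring
  rw [hkey]
  have h1 : |q.re * Complex.arg q| ≤ q.re * (π / 2) := by
    rw [abs_mul, abs_of_nonneg hqre0]; exact mul_le_mul_of_nonneg_left harg hqre0
  have h2 : 0 ≤ q.im * (Real.log ‖q‖ - Real.log q.im) := mul_nonneg hqim0.le (by linarith)
  have h3 : q.im * (Real.log ‖q‖ - Real.log q.im) ≤ q.re := by
    have := mul_le_mul_of_nonneg_left hlog_hi hqim0.le
    rwa [mul_div_cancel₀ _ hqim0.ne'] at this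
  have h4 : q.re * (π / 2) + q.re ≤ a := by
    rw [hqre]
    have hπ3 := Real.pi_gt_three
    have : a / (4 * π) * (π / 2) + a / (4 * π) = a * ((π / 2 + 1) / (4 * π)) := by ring
    rw [this]
    have hfrac : (π / 2 + 1) / (4 * π) ≤ 1 := by
      rw [div_le_one hπ]; linarith
    exact mul_le_of_le_one_right ha0 hfrac
  calc |q.re * Complex.arg q + q.im * (Real.log ‖q‖ - Real.log q.im)|
      ≤ |q.re * Complex.arg q| + |q.im * (Real.log ‖q‖ - Real.log q.im)| := abs_add_le _ _
    _ ≤ q.re * (π / 2) + q.re := by rw [abs_of_nonneg h2]; exact add_le_add h1 h3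
    _ ≤ a := h4

/-- Perturbing the right end point off the (isolated) zeros: there is `T′ ∈ (T, T + 1]` which is
not a zero of `H_t` and such that `H_t` has no zeros in `(T, T′]`.
[cite: RodgersTaoFMP2020, §3 proof of (48) p.24 («By perturbing `T` slightly if necessary, we may assume that `T` is not a zero of `H_t`»)] -/
theorem exists_zero_free_right (t T : ℝ) :
    ∃ T' : ℝ, T < T' ∧ T' ≤ T + 1 ∧ ∀ x : ℝ, T < x → x ≤ T' → deBruijnH t x ≠ 0 := by
  classical
  have hfin : {x : ℝ | x ∈ Ioc T (T + 1) ∧ deBruijnH t x = 0}.Finite :=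
    (finite_real_zeros_deBruijnH_Icc t T (T + 1)).subset fun x hx ↦ ⟨⟨hx.1.1.le, hx.1.2⟩, hx.2⟩
  set Z : Finset ℝ := hfin.toFinset with hZ
  by_cases hne : Z.Nonempty
  · set m : ℝ := Z.min' hne with hm
    have hmZ : m ∈ Z := Finset.min'_mem Z hne
    rw [hZ, Set.Finite.mem_toFinset] at hmZ
    refine ⟨(T + m) / 2, by linarith [hmZ.1.1], by linarith [hmZ.1.2], fun x hx1 hx2 h0 ↦ ?_⟩
    have hxZ : x ∈ Z := by
      rw [hZ, Set.Finite.mem_toFinset]; exact ⟨⟨hx1, by linarith [hmZ.1.2]⟩, h0⟩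
    have := Z.min'_le x hxZ
    rw [← hm] at this
    linarith [hmZ.1.1]
  · refine ⟨T + 1, by linarith, le_rfl, fun x hx1 hx2 h0 ↦ hne ⟨x, ?_⟩⟩
    rw [hZ, Set.Finite.mem_toFinset]; exact ⟨⟨hx1, hx2⟩, h0⟩

/-- `Ψ` grows slowly: `|Ψ(T′) − Ψ(T)| ≤ log₊ T` for `4π ≤ T ≤ T′ ≤ T + 1` (mean value theorem,
`Ψ′ = log(·/4π)/4π`). [cite: RodgersTaoFMP2020, §3 eq. (39) p.20] -/
theorem abs_rodgersTaoPsi_sub_le {T T' : ℝ} (hT : 4 * π ≤ T) (hTT' : T ≤ T') (hT'1 : T' ≤ T + 1) :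
    |rodgersTaoPsi T' - rodgersTaoPsi T| ≤ logPlus T := by
  have hπ : 0 < 4 * π := by positivity
  have hT0 : 0 < T := hπ.trans_le hT
  rcases hTT'.eq_or_lt with h | hlt
  · rw [← h, sub_self, abs_zero]; exact (logPlus_pos T).le
  obtain ⟨ξ, hξ, hslope⟩ := exists_hasDerivAt_eq_slope rodgersTaoPsi
    (fun ξ ↦ Real.log (ξ / (4 * π)) / (4 * π)) hlt continuous_rodgersTaoPsi.continuousOn
    (fun ξ hξ ↦ hasDerivAt_rodgersTaoPsi (by linarith [hξ.1] : ξ ≠ 0))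
  have hξ0 : 0 < ξ := hT0.trans hξ.1
  have hd_nonneg : 0 ≤ Real.log (ξ / (4 * π)) / (4 * π) :=
    div_nonneg (Real.log_nonneg (by rw [le_div_iff₀ hπ]; linarith [hξ.1])) hπ.le
  have hd_le : Real.log (ξ / (4 * π)) / (4 * π) ≤ logPlus T := by
    have h1 : Real.log (ξ / (4 * π)) ≤ Real.log (2 + T) := by
      apply Real.log_le_log (div_pos hξ0 hπ)
      rw [div_le_iff₀ hπ]
      have hπ1 : (1 : ℝ) ≤ 4 * π := by linarith [Real.pi_gt_three]
      nlinarith [hξ.2]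
    have h2 : Real.log (2 + T) = logPlus T := by rw [logPlus_eq, abs_of_pos hT0]
    have h3 : 0 ≤ Real.log (ξ / (4 * π)) := Real.log_nonneg (by rw [le_div_iff₀ hπ]; linarith [hξ.1])
    rw [div_le_iff₀ hπ, ← h2]
    have hπ1 : (1 : ℝ) ≤ 4 * π := by linarith [Real.pi_gt_three]
    nlinarith [Real.log_nonneg (by linarith : (1 : ℝ) ≤ 2 + T)]
  have heq : rodgersTaoPsi T' - rodgersTaoPsi T = Real.log (ξ / (4 * π)) / (4 * π) * (T' - T) := by
    rw [hslope, div_mul_cancel₀ _ (by linarith)]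
  rw [heq, abs_of_nonneg (mul_nonneg hd_nonneg (by linarith))]
  calc Real.log (ξ / (4 * π)) / (4 * π) * (T' - T) ≤ logPlus T * 1 :=
        mul_le_mul hd_le (by linarith) (by linarith) (logPlus_pos T).le
    _ = logPlus T := mul_one _

/-- `|Ψ(T)| ≤ 1 + |Ψ(T*)|` for `0 < T ≤ T*`, `T* ≥ 4π` (`Ψ ≥ −1`; `Ψ ≤ 0` on `(0, 4π]`, increasing
after). [cite: RodgersTaoFMP2020, §3 eq. (38)–(39) p.20] -/
theorem abs_rodgersTaoPsi_le {T Ts : ℝ} (hT : 0 < T) (hTs : T ≤ Ts) (h4 : 4 * π ≤ Ts) :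
    |rodgersTaoPsi T| ≤ 1 + |rodgersTaoPsi Ts| := by
  have hπ : 0 < 4 * π := by positivity
  have hlo := RodgersTao2020.neg_one_le_rodgersTaoPsi hT.le
  have hhi : rodgersTaoPsi T ≤ |rodgersTaoPsi Ts| := by
    rcases le_or_gt T (4 * π) with h | h
    · have : rodgersTaoPsi T ≤ 0 := by
        rw [rodgersTaoPsi]
        have h1 : Real.log (T / (4 * π)) ≤ 0 :=
          Real.log_nonpos (div_pos hT hπ).le (by rw [div_le_one hπ]; exact h)
        have h2 : 0 ≤ T / (4 * π) := by positivity
        nlinarith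
      exact this.trans (abs_nonneg _)
    · exact (strictMonoOn_rodgersTaoPsi.monotoneOn h.le h4 hTs).trans (le_abs_self _)
  have := abs_nonneg (rodgersTaoPsi Ts)
  rw [abs_le]; constructor <;> linarith

end MainTerm

/-! ## H. Book-keeping lemmas for the assembly -/

section Assembly

variable {t : ℝ} {β : ℕ → ℝ}

/-- The finite set of indices whose factor is negative at the real point `u`. [folklore] -/
private theorem exists_finset_neg (hs : Summable fun n ↦ ‖(β n : ℂ)‖) (u : ℝ) :
    ∃ F : Finset ℕ, ∀ n, n ∈ F ↔ 1 + β n * u ^ 2 < 0 := by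
  have hfin : {n : ℕ | 1 + β n * u ^ 2 < 0}.Finite := by
    refine (finite_large hs u).subset fun n hn ↦ ?_
    simp only [Set.mem_setOf_eq] at hn ⊢
    have h1 : 1 < -(β n * u ^ 2) := by linarith
    have h2 : -(β n * u ^ 2) ≤ ‖β n‖ * u ^ 2 := by
      rw [Real.norm_eq_abs, neg_mul_eq_neg_mul]
      exact mul_le_mul_of_nonneg_right (neg_le_abs _) (sq_nonneg _)
    linarith
  exact ⟨hfin.toFinset, fun n ↦ by rw [Set.Finite.mem_toFinset, Set.mem_setOf_eq]⟩

/-- The integrand `(H_t′/H_t)(γ(x)) γ′(x)` is continuous on `[a, b]` (`0 < a`). [folklore] -/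
private theorem continuousOn_logDeriv_curve (hreal : HasOnlyRealZeros (deBruijnH t)) {κ a b : ℝ}
    (hκ : 0 < κ) (ha : 0 < a) :
    ContinuousOn (fun x : ℝ ↦
      deriv (deBruijnH t) (rodgersTaoZ x κ) / deBruijnH t (rodgersTaoZ x κ) *
        (1 - I * ((κ / (2 + x) : ℝ) : ℂ))) (Icc a b) := by
  refine ContinuousOn.mul (ContinuousOn.div ?_ ?_ fun x _ ↦ ?_) ?_
  · exact ((continuous_deriv_deBruijnH t).comp (continuous_rodgersTaoZ κ)).continuousOn
  · exact (((differentiable_deBruijnH_holds t).continuous).comp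
      (continuous_rodgersTaoZ κ)).continuousOn
  · exact deBruijnH_ne_zero_of_im_neg hreal (rodgersTaoZ_im_neg hκ)
  · have h2x : ∀ x ∈ Icc a b, (2 : ℝ) + x ≠ 0 := fun x hx ↦ by linarith [hx.1]
    have hq : ContinuousOn (fun x : ℝ ↦ κ / (2 + x)) (Icc a b) :=
      continuousOn_const.div (by fun_prop) h2x
    exact continuousOn_const.sub (continuousOn_const.mul
      (Complex.continuous_ofReal.comp_continuousOn hq))

/-- The main-term integrand `(i/4) log(iγ(x)/4π) γ′(x)` is continuous on `[a, b]` (`0 < a`).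
[folklore] -/
private theorem continuousOn_mainTerm {κ a b : ℝ} (hκ : 0 < κ) (ha : 0 < a) :
    ContinuousOn (fun x : ℝ ↦ I / 4 * Complex.log (I * rodgersTaoZ x κ / (4 * π)) *
      (1 - I * ((κ / (2 + x) : ℝ) : ℂ))) (Icc a b) := by
  have hsl : ∀ x : ℝ, I * rodgersTaoZ x κ / (4 * π) ∈ slitPlane := by
    intro x
    rw [mem_slitPlane_iff]; left
    have : (I * rodgersTaoZ x κ / (4 * π)).re = (I * rodgersTaoZ x κ).re / (4 * π) := by
      have e : (4 * (π : ℂ)) = ((4 * π : ℝ) : ℂ) := by push_cast; ring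
      rw [e, Complex.div_ofReal_re]
    rw [this]; exact div_pos (I_mul_rodgersTaoZ_re_pos hκ) (by positivity)
  refine ContinuousOn.mul (ContinuousOn.mul continuousOn_const ?_) ?_
  · refine ContinuousOn.clog ?_ fun x _ ↦ hsl x
    exact ((continuous_const.mul (continuous_rodgersTaoZ κ)).div_const _).continuousOn
  · have h2x : ∀ x ∈ Icc a b, (2 : ℝ) + x ≠ 0 := fun x hx ↦ by linarith [hx.1]
    have hq : ContinuousOn (fun x : ℝ ↦ κ / (2 + x)) (Icc a b) :=
      continuousOn_const.div (by fun_prop) h2x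
    exact continuousOn_const.sub (continuousOn_const.mul
      (Complex.continuous_ofReal.comp_continuousOn hq))

/-- `log₊ T′ ≤ 2 log₊ T` for `1 ≤ T ≤ T′ ≤ T + 1`. [folklore] -/
private theorem logPlus_le_two_mul_of_le_add_one {T T' : ℝ} (hT : 1 ≤ T) (hTT' : T ≤ T') (hT'1 : T' ≤ T + 1) :
    logPlus T' ≤ 2 * logPlus T :=
  (logPlus_le_logPlus_of_le (by linarith) (by linarith : T' ≤ 2 * T)).trans
    (logPlus_two_mul_le (by linarith))

/-- `log 2 ≤ log₊ x`, packaged as `c ≤ (c / log 2) · log₊ x` for `c ≥ 0`. [folklore] -/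
private theorem le_div_log_two_mul_logPlus {c : ℝ} (hc : 0 ≤ c) (x : ℝ) :
    c ≤ c / Real.log 2 * logPlus x := by
  have hl : 0 < Real.log 2 := Real.log_pos one_lt_two
  rw [div_mul_eq_mul_div, le_div_iff₀ hl]
  exact mul_le_mul_of_nonneg_left (log_two_le_logPlus x) hc

/-- `log₊ x ≤ log₊² x / log 2`. [folklore] -/
private theorem logPlus_le_sq_div_log_two (x : ℝ) : logPlus x ≤ logPlus x ^ 2 / Real.log 2 := by
  have hl : 0 < Real.log 2 := Real.log_pos one_lt_two
  rw [le_div_iff₀ hl, sq]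
  exact mul_le_mul_of_nonneg_left (log_two_le_logPlus x) (logPlus_pos x).le

-- the assembly elaborates in ≈ 170k heartbeats (many `set`/`linarith` steps); 400k per rule KK(iii)
set_option maxHeartbeats 400000 in
/-- **The contour argument for large `T`** (`T > X₀ + 1`): the count `N_t([0,T])` against
`Ψ(T)`, with every error term explicit. Ingredients: perturb `T ↦ T′ ∈ (T, T+1]` and
`X₀ ↦ X₁ ∈ (X₀, X₀+1]` off the zeros; `πN_t((0,T′)) = Im L(T′)`, `πN_t((0,X₁)) = Im L(X₁)`;
`Im L(T′) − Im L(X₁)` = (vertical at `T′`) + (curve `Γ_I` from `X₁` to `T′`) + (vertical at `X₁`);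
the curve integral = `π[Ψ(iz)]` + error by (9); Backlund/Jensen on the verticals; Jensen for the
zeros below `X₀ + 1`. [cite: RodgersTaoFMP2020, Theorem 3.2 (48) = Theorem 9 (48) p.23, proof pp.24–25] -/
theorem abs_count_sub_psi_le_of_large (h : IsHadamardSeq t (fun n ↦ (β n : ℂ)))
    (hβ : ∀ n, β n ≤ 0) (hreal : HasOnlyRealZeros (deBruijnH t))
    (hsimple : ∀ x : ℝ, deBruijnH t x = 0 → deriv (deBruijnH t) x ≠ 0)
    {κ C'' C₇ A X₀ T : ℝ} (hκ : 0 < κ) (hA : 0 ≤ A) (hC''X₀ : C'' ≤ X₀) (hX₀16 : 16 ≤ X₀)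
    (hX₀κ : (8 * κ + 2) ^ 2 ≤ X₀) (hC₇ : 6 * (1 + κ) * (X₀ + 2) ≤ C₇)
    (h7 : ∀ x : ℝ, 0 ≤ x → ∀ κ' ∈ Icc 0 C₇,
      ‖deBruijnH t (rodgersTaoZ x κ')‖ ≤ Real.exp (-(π * x / 8) + A * logPlus x ^ 2))
    (h8 : ∀ x : ℝ, C'' ≤ x →
      Real.exp (-(π * x / 8) - A * logPlus x ^ 2) ≤ ‖deBruijnH t (rodgersTaoZ x κ)‖)
    (h9 : ∀ x : ℝ, C'' ≤ x →
      ‖deriv (deBruijnH t) (rodgersTaoZ x κ) / deBruijnH t (rodgersTaoZ x κ) -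
          I / 4 * Complex.log (I * rodgersTaoZ x κ / (4 * π))‖ ≤ A * logPlus x / x)
    (hT : X₀ + 1 < T) :
    |(deBruijnZeroCount t (Icc 0 T) : ℝ) - rodgersTaoPsi T| ≤
      (A * logPlus (X₀ + 2 * (1 + κ) * (X₀ + 1)) ^ 2 + π * X₀ / 8 + A * logPlus X₀ ^ 2) /
          Real.log 2 +
        (κ * logPlus (X₀ + 1) + 1 + |rodgersTaoPsi (X₀ + 1)|) +
        (π * (κ * logPlus (X₀ + 1)) / 4 + (4 * A + A) * logPlus (X₀ + 1) ^ 2) / Real.log 2 +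
        (π * (κ * logPlus T) / 2 + (4 * A + A) * (4 * logPlus T ^ 2)) / Real.log 2 +
        2 * (κ * logPlus T) + logPlus T + A * (1 + κ) * (4 * logPlus T ^ 2) := by
  have hπ := Real.pi_pos
  have hπ3 := Real.pi_gt_three
  have hl2 : 0 < Real.log 2 := Real.log_pos one_lt_two
  have hX₀4π : 4 * π ≤ X₀ := by linarith [Real.pi_lt_d2]
  have hX₀0 : 0 < X₀ := by linarith
  have hT1 : 1 ≤ T := by linarith
  have hT4π : 4 * π ≤ T := by linarith
  -- perturbations off the zeros
  obtain ⟨T', hTT', hT'1, hfreeT⟩ := exists_zero_free_right t T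
  obtain ⟨X₁, hX₀X₁, hX₁1, hfreeX⟩ := exists_zero_free_right t X₀
  have hHT' : deBruijnH t T' ≠ 0 := hfreeT T' hTT' le_rfl
  have hHX₁ : deBruijnH t X₁ ≠ 0 := hfreeX X₁ hX₀X₁ le_rfl
  have hX₁T' : X₁ ≤ T' := by linarith
  have hX₁0 : 0 < X₁ := by linarith
  have hT'0 : 0 < T' := by linarith
  have h4T' : 4 * (κ * logPlus T') ≤ T' := four_mul_logPlus_le hκ (by linarith)
  have h4X₁ : 4 * (κ * logPlus X₁) ≤ X₁ := four_mul_logPlus_le hκ (by linarith)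
  have hC₇6 : 6 * κ ≤ C₇ := by nlinarith
  have hC₇' : 6 * (1 + κ) * (X₀ + 1) ≤ C₇ := by nlinarith
  -- the finite index sets at `T′` and `X₁`
  obtain ⟨FT, hFT⟩ := exists_finset_neg h.summable T'
  obtain ⟨FX, hFX⟩ := exists_finset_neg h.summable X₁
  -- `N_t([0,T]) = #FT`
  have hcountT : (deBruijnZeroCount t (Icc 0 T) : ℝ) = FT.card := by
    have hset : {x : ℝ | x ∈ Icc 0 T ∧ deBruijnH t x = 0} =
        {x : ℝ | x ∈ Ioo 0 T' ∧ deBruijnH t x = 0} := by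
      ext x
      simp only [Set.mem_setOf_eq, Set.mem_Icc, Set.mem_Ioo]
      constructor
      · rintro ⟨⟨h0, h1⟩, hx⟩
        refine ⟨⟨lt_of_le_of_ne h0 ?_, by linarith⟩, hx⟩
        rintro h00; rw [← h00] at hx; exact deBruijnH_apply_zero_ne_zero t (by simpa using hx)
      · rintro ⟨⟨h0, h1⟩, hx⟩
        refine ⟨⟨h0.le, ?_⟩, hx⟩
        by_contra hxT
        exact hfreeT x (lt_of_not_ge hxT) h1.le hx
    rw [deBruijnZeroCount_eq, hset, ncard_zeros_Ioo_eq_card h hsimple hT'0 FT hFT]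
  -- `#FX ≤` the small-zeros bound
  have hcountX : (FX.card : ℝ) * Real.log 2 ≤
      A * logPlus (X₀ + 2 * (1 + κ) * (X₀ + 1)) ^ 2 + π * X₀ / 8 + A * logPlus X₀ ^ 2 := by
    have h1 : {x : ℝ | x ∈ Ioo 0 X₁ ∧ deBruijnH t x = 0}.ncard = FX.card :=
      ncard_zeros_Ioo_eq_card h hsimple hX₁0 FX hFX
    have hfin : {x : ℝ | x ∈ Ioc 0 (X₀ + 1) ∧ deBruijnH t x = 0}.Finite :=
      (finite_real_zeros_deBruijnH_Icc t 0 (X₀ + 1)).subset fun x hx ↦ ⟨⟨hx.1.1.le, hx.1.2⟩, hx.2⟩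
    have h2 : {x : ℝ | x ∈ Ioo 0 X₁ ∧ deBruijnH t x = 0}.ncard ≤
        {x : ℝ | x ∈ Ioc 0 (X₀ + 1) ∧ deBruijnH t x = 0}.ncard :=
      Set.ncard_le_ncard (fun x hx ↦ ⟨⟨hx.1.1, hx.1.2.le.trans hX₁1⟩, hx.2⟩) hfin
    have h3 := ncard_small_zeros_mul_log_two_le (t := t) hκ hX₀0 hA h7 hC₇' (h8 X₀ hC''X₀)
    have h4 : (FX.card : ℝ) ≤ ({x : ℝ | x ∈ Ioc 0 (X₀ + 1) ∧ deBruijnH t x = 0}.ncard : ℝ) := by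
      rw [← h1]; exact_mod_cast h2
    nlinarith
  -- the arguments of the Hadamard product at the real points
  have hImT := im_tsum_log_ofReal h.summable T' FT hFT
  have hImX := im_tsum_log_ofReal h.summable X₁ FX hFX
  -- Backlund on the two vertical segments
  have hvT := abs_im_vertical_le h hβ hreal hκ hA hC₇6 h7 (h8 T' (by linarith)) h4T' hHT'
  have hvX := abs_im_vertical_le h hβ hreal hκ hA hC₇6 h7 (h8 X₁ (by linarith)) h4X₁ hHX₁
  -- the curve `Γ_I`
  have hcurve := integral_logDeriv_curve h hβ hreal hκ hX₁0 hX₁T'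
  have hmain := integral_mainTerm_curve hκ hX₁0 hX₁T'
  have herr := norm_integral_error_le (κ := κ)
    (E := fun x : ℝ ↦ deriv (deBruijnH t) (rodgersTaoZ x κ) / deBruijnH t (rodgersTaoZ x κ) -
      I / 4 * Complex.log (I * rodgersTaoZ x κ / (4 * π)))
    hκ.le (by linarith : (2 : ℝ) ≤ X₁) hX₁T' (fun x hx ↦ h9 x (by linarith [hx.1]))
  have hiL : IntervalIntegrable (fun x : ℝ ↦
      deriv (deBruijnH t) (rodgersTaoZ x κ) / deBruijnH t (rodgersTaoZ x κ) *
        (1 - I * ((κ / (2 + x) : ℝ) : ℂ))) volume X₁ T' := by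
    refine ContinuousOn.intervalIntegrable ?_
    rw [uIcc_of_le hX₁T']; exact continuousOn_logDeriv_curve hreal hκ hX₁0
  have hiM : IntervalIntegrable (fun x : ℝ ↦ I / 4 * Complex.log (I * rodgersTaoZ x κ / (4 * π)) *
      (1 - I * ((κ / (2 + x) : ℝ) : ℂ))) volume X₁ T' := by
    refine ContinuousOn.intervalIntegrable ?_
    rw [uIcc_of_le hX₁T']; exact continuousOn_mainTerm hκ hX₁0
  have herr_val : (∫ x in X₁..T',
      (deriv (deBruijnH t) (rodgersTaoZ x κ) / deBruijnH t (rodgersTaoZ x κ) -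
        I / 4 * Complex.log (I * rodgersTaoZ x κ / (4 * π))) * (1 - I * ((κ / (2 + x) : ℝ) : ℂ))) =
      ((∑' n, Complex.log (1 + (β n : ℂ) * rodgersTaoZ T' κ ^ 2)) -
          ∑' n, Complex.log (1 + (β n : ℂ) * rodgersTaoZ X₁ κ ^ 2)) -
        ((π : ℂ) * ((I * rodgersTaoZ T' κ) / (4 * π) * Complex.log ((I * rodgersTaoZ T' κ) / (4 * π)) -
            (I * rodgersTaoZ T' κ) / (4 * π)) -
          (π : ℂ) * ((I * rodgersTaoZ X₁ κ) / (4 * π) *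
            Complex.log ((I * rodgersTaoZ X₁ κ) / (4 * π)) - (I * rodgersTaoZ X₁ κ) / (4 * π))) := by
    rw [← hcurve, ← hmain, ← intervalIntegral.integral_sub hiL hiM]
    refine intervalIntegral.integral_congr fun x _ ↦ ?_
    ring
  -- the main-term values
  have hψT := abs_im_psiC_sub_psi_le hT'0 hκ.le
  have hψX := abs_im_psiC_sub_psi_le hX₁0 hκ.le
  have hΨinc := abs_rodgersTaoPsi_sub_le hT4π hTT'.le hT'1
  have hΨX₁ := abs_rodgersTaoPsi_le hX₁0 hX₁1 (by linarith : 4 * π ≤ X₀ + 1)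
  -- logarithms
  have hLT' : logPlus T' ≤ 2 * logPlus T := logPlus_le_two_mul_of_le_add_one hT1 hTT'.le hT'1
  have hLX₁ : logPlus X₁ ≤ logPlus (X₀ + 1) := logPlus_le_logPlus_of_le hX₁0.le hX₁1
  have hL0 : 0 < logPlus T := logPlus_pos T
  have hL'0 : 0 < logPlus T' := logPlus_pos T'
  have hL₁0 : 0 < logPlus X₁ := logPlus_pos X₁
  -- name the real quantities
  set aT : ℝ := (∑' n, Complex.log (1 + (β n : ℂ) * (T' : ℂ) ^ 2)).im with haT
  set aγT : ℝ := (∑' n, Complex.log (1 + (β n : ℂ) * rodgersTaoZ T' κ ^ 2)).im with haγT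
  set aγX : ℝ := (∑' n, Complex.log (1 + (β n : ℂ) * rodgersTaoZ X₁ κ ^ 2)).im with haγX
  set aX : ℝ := (∑' n, Complex.log (1 + (β n : ℂ) * (X₁ : ℂ) ^ 2)).im with haX
  set pT : ℝ := ((I * rodgersTaoZ T' κ) / (4 * π) * Complex.log ((I * rodgersTaoZ T' κ) / (4 * π)) -
      (I * rodgersTaoZ T' κ) / (4 * π)).im with hpT
  set pX : ℝ := ((I * rodgersTaoZ X₁ κ) / (4 * π) * Complex.log ((I * rodgersTaoZ X₁ κ) / (4 * π)) -
      (I * rodgersTaoZ X₁ κ) / (4 * π)).im with hpX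
  set Err : ℂ := ∫ x in X₁..T',
      (deriv (deBruijnH t) (rodgersTaoZ x κ) / deBruijnH t (rodgersTaoZ x κ) -
        I / 4 * Complex.log (I * rodgersTaoZ x κ / (4 * π))) * (1 - I * ((κ / (2 + x) : ℝ) : ℂ))
    with hErr
  -- the identity along the contour
  have hid : aγT - aγX = π * pT - π * pX + Err.im := by
    have := congrArg Complex.im herr_val
    rw [Complex.sub_im, Complex.sub_im, Complex.sub_im, Complex.im_ofReal_mul,
      Complex.im_ofReal_mul] at this
    linarith
  have hvT' : |aγT - aT| ≤ π * (π * (κ * logPlus T') / 4 + (4 * A + A) * logPlus T' ^ 2) / Real.log 2 := by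
    rw [haγT, haT, ← Complex.sub_im]; exact hvT
  have hvX' : |aγX - aX| ≤ π * (π * (κ * logPlus X₁) / 4 + (4 * A + A) * logPlus X₁ ^ 2) / Real.log 2 := by
    rw [haγX, haX, ← Complex.sub_im]; exact hvX
  have herr' : |Err.im| ≤ A * (1 + κ) * (logPlus T' ^ 2 - logPlus X₁ ^ 2) :=
    (abs_im_le_norm _).trans herr
  -- counts as arguments
  have hN : π * (deBruijnZeroCount t (Icc 0 T) : ℝ) = aT := by rw [hcountT]; linarith [hImT]
  have hNX : aX = π * FX.card := hImX
  -- monotone replacements `T′ ↦ T`, `X₁ ↦ X₀ + 1`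
  have hA5 : 0 ≤ 4 * A + A := by positivity
  have hm4 : κ * logPlus T' ≤ 2 * (κ * logPlus T) := by
    have := mul_le_mul_of_nonneg_left hLT' hκ.le; linarith
  have hm5 : κ * logPlus X₁ ≤ κ * logPlus (X₀ + 1) := mul_le_mul_of_nonneg_left hLX₁ hκ.le
  have hsqT : logPlus T' ^ 2 ≤ 4 * logPlus T ^ 2 := by
    calc logPlus T' ^ 2 ≤ (2 * logPlus T) ^ 2 := pow_le_pow_left₀ hL'0.le hLT' 2
      _ = 4 * logPlus T ^ 2 := by ring
  have hsqX : logPlus X₁ ^ 2 ≤ logPlus (X₀ + 1) ^ 2 := pow_le_pow_left₀ hL₁0.le hLX₁ 2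
  have hm1 : π * (π * (κ * logPlus T') / 4 + (4 * A + A) * logPlus T' ^ 2) / Real.log 2 ≤
      π * (π * (κ * logPlus T) / 2 + (4 * A + A) * (4 * logPlus T ^ 2)) / Real.log 2 := by
    gcongr π * (?_ ) / Real.log 2
    have h1 := mul_le_mul_of_nonneg_left hm4 hπ.le
    have h2 := mul_le_mul_of_nonneg_left hsqT hA5
    linarith
  have hm2 : π * (π * (κ * logPlus X₁) / 4 + (4 * A + A) * logPlus X₁ ^ 2) / Real.log 2 ≤
      π * (π * (κ * logPlus (X₀ + 1)) / 4 + (4 * A + A) * logPlus (X₀ + 1) ^ 2) / Real.log 2 := by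
    gcongr π * (?_ ) / Real.log 2
    have h1 := mul_le_mul_of_nonneg_left hm5 hπ.le
    have h2 := mul_le_mul_of_nonneg_left hsqX hA5
    linarith
  have hm3 : A * (1 + κ) * (logPlus T' ^ 2 - logPlus X₁ ^ 2) ≤ A * (1 + κ) * (4 * logPlus T ^ 2) := by
    have h2 : logPlus T' ^ 2 - logPlus X₁ ^ 2 ≤ 4 * logPlus T ^ 2 := by
      linarith [sq_nonneg (logPlus X₁)]
    exact mul_le_mul_of_nonneg_left h2 (by positivity)
  have hFX' : (FX.card : ℝ) ≤ (A * logPlus (X₀ + 2 * (1 + κ) * (X₀ + 1)) ^ 2 + π * X₀ / 8 +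
      A * logPlus X₀ ^ 2) / Real.log 2 := by
    rw [le_div_iff₀ hl2]; exact hcountX
  -- assemble: `π (N − Ψ T) = (aT − aγT) + π(pT − Ψ T′) + π(Ψ T′ − Ψ T) − π pX + Err.im + (aγX − aX) + π #FX`
  have hkey : π * ((deBruijnZeroCount t (Icc 0 T) : ℝ) - rodgersTaoPsi T) =
      (aT - aγT) + π * (pT - rodgersTaoPsi T') + π * (rodgersTaoPsi T' - rodgersTaoPsi T) -
        π * pX + Err.im + (aγX - aX) + π * FX.card := by
    rw [mul_sub, hN, ← hNX]; linarith [hid]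
  -- bound each term
  have b1 := abs_le.1 (hvT'.trans hm1)
  have b2 : |π * (pT - rodgersTaoPsi T')| ≤ π * (2 * (κ * logPlus T)) := by
    rw [abs_mul, abs_of_pos hπ]; exact mul_le_mul_of_nonneg_left (hψT.trans hm4) hπ.le
  have b3 : |π * (rodgersTaoPsi T' - rodgersTaoPsi T)| ≤ π * logPlus T := by
    rw [abs_mul, abs_of_pos hπ]; exact mul_le_mul_of_nonneg_left hΨinc hπ.le
  have b4 : |π * pX| ≤ π * (κ * logPlus (X₀ + 1) + 1 + |rodgersTaoPsi (X₀ + 1)|) := by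
    rw [abs_mul, abs_of_pos hπ]
    refine mul_le_mul_of_nonneg_left ?_ hπ.le
    have : |pX| ≤ |pX - rodgersTaoPsi X₁| + |rodgersTaoPsi X₁| := by
      have := abs_add_le (pX - rodgersTaoPsi X₁) (rodgersTaoPsi X₁); simpa using this
    linarith
  have b5 : |Err.im| ≤ π * (A * (1 + κ) * (4 * logPlus T ^ 2)) := by
    have h1 := herr'.trans hm3
    have h2 : 0 ≤ A * (1 + κ) * (4 * logPlus T ^ 2) := by positivity
    exact h1.trans (le_mul_of_one_le_left h2 (by linarith))
  have b6 := abs_le.1 (hvX'.trans hm2)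
  have b7 : 0 ≤ (FX.card : ℝ) := by positivity
  rw [← mul_le_mul_iff_of_pos_left hπ, ← abs_of_pos hπ, ← abs_mul, abs_of_pos hπ, hkey]
  have e2 := abs_le.1 b2
  have e3 := abs_le.1 b3
  have e4 := abs_le.1 b4
  have e5 := abs_le.1 b5
  have e7 := mul_le_mul_of_nonneg_left hFX' hπ.le
  have e8 : 0 ≤ π * (FX.card : ℝ) := by positivity
  -- name the seven majorants and add them up
  set M1 : ℝ := π * (π * (κ * logPlus T) / 2 + (4 * A + A) * (4 * logPlus T ^ 2)) / Real.log 2 with hM1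
  set M2 : ℝ := π * (2 * (κ * logPlus T)) with hM2
  set M3 : ℝ := π * logPlus T with hM3
  set M4 : ℝ := π * (κ * logPlus (X₀ + 1) + 1 + |rodgersTaoPsi (X₀ + 1)|) with hM4
  set M5 : ℝ := π * (A * (1 + κ) * (4 * logPlus T ^ 2)) with hM5
  set M6 : ℝ := π * (π * (κ * logPlus (X₀ + 1)) / 4 + (4 * A + A) * logPlus (X₀ + 1) ^ 2) /
    Real.log 2 with hM6
  set M7 : ℝ := π * ((A * logPlus (X₀ + 2 * (1 + κ) * (X₀ + 1)) ^ 2 + π * X₀ / 8 +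
      A * logPlus X₀ ^ 2) / Real.log 2) with hM7
  have htot : π * ((A * logPlus (X₀ + 2 * (1 + κ) * (X₀ + 1)) ^ 2 + π * X₀ / 8 + A * logPlus X₀ ^ 2) /
          Real.log 2 +
        (κ * logPlus (X₀ + 1) + 1 + |rodgersTaoPsi (X₀ + 1)|) +
        (π * (κ * logPlus (X₀ + 1)) / 4 + (4 * A + A) * logPlus (X₀ + 1) ^ 2) / Real.log 2 +
        (π * (κ * logPlus T) / 2 + (4 * A + A) * (4 * logPlus T ^ 2)) / Real.log 2 +
        2 * (κ * logPlus T) + logPlus T + A * (1 + κ) * (4 * logPlus T ^ 2)) =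
      M1 + M2 + M3 + M4 + M5 + M6 + M7 := by
    rw [hM1, hM2, hM3, hM4, hM5, hM6, hM7]; ring
  rw [htot, abs_le]
  constructor
  · linarith [b1.1, b1.2, b6.1, b6.2, e2.1, e2.2, e3.1, e3.2, e4.1, e4.2, e5.1, e5.2, e7, e8]
  · linarith [b1.1, b1.2, b6.1, b6.2, e2.1, e2.2, e3.1, e3.2, e4.1, e4.2, e5.1, e5.2, e7, e8]

end Assembly

end RodgersTaoZeroCounting

/-! ## I. Theorem 3.2 (48): the RH-free content twin and its corollary over the kernel theorems -/

namespace RodgersTao2020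

open RodgersTaoZeroCounting

/-- RH-FREE CONTENT TWIN of Rodgers–Tao 2020 **Theorem 3.2, eq. (48)** = FMP Theorem 9 (48), p.23:
«Let `Λ < t ≤ 0`, `T > 0` … Then one has `N_t([0,T]) = Ψ(T) + O(log²₊ T)`» — here at ONE time
`t`, with the printed inputs made explicit hypotheses: all zeros of `H_t` real and simple (the
standing description of §1.2 for `t > Λ`, Csordas–Smith–Varga), the majorant (7) for
`0 ≤ κ′ ≤ C₇`, the lower half of (8) and the logarithmic-derivative asymptotics (9) at one
`κ > 0` for `x ≥ C″` (the INNER shapes of the typed §2 facts `rodgersTao_H_bound`,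
`rodgersTao_H_asymp`, `rodgersTao_logDeriv_H_asymp`). The constant `A′` is produced BEFORE `t`
(it depends on `κ, C″, A` only), so the estimate is uniform in `t`.
Proof as printed (pp.24–25): argument principle along `Γ_I ∪ Γ_II`, FTC with (9) on `Γ_I`
(`(1/π) H_t′/H_t = (d/dz)Ψ(iz) + O(log₊ x/x)`, `Im Ψ(iT + κ log₊ T) = Ψ(T) + O(log²₊ T)`),
Backlund/Jensen on `Γ_II` (`m′ ≪ log²₊ T`). DIVERGENCE from print (declared): the argument principle
is realised through the grouped Hadamard product of `H_t` (no residue theorem), and — because the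
typed (9) holds for `x ≥ C″` only — the contour starts at `X₀ = max(C″, (8κ+2)² + 16)` instead of
`x = 0`, the zeros below `X₀ + 1` and the vertical segment at `X₀` being paid for by Jensen's
formula (`O(1)` uniformly in `t`). No hypothesis `t ≤ 0`, no use of `Λ`.
[cite: RodgersTaoFMP2020, Theorem 3.2 (48) = Theorem 9 (48) p.23] -/
theorem thm32_bigO_of_asymptotics {κ C'' C₇ A : ℝ} (hκ : 0 < κ) (hC'' : 0 < C'') (hA : 0 ≤ A)
    (hC₇ : 6 * (1 + κ) * (max C'' ((8 * κ + 2) ^ 2 + 16) + 2) ≤ C₇) :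
    ∃ A' : ℝ, ∀ t : ℝ, HasOnlyRealZeros (deBruijnH t) →
      (∀ x : ℝ, deBruijnH t x = 0 → deriv (deBruijnH t) x ≠ 0) →
      (∀ x : ℝ, 0 ≤ x → ∀ κ' ∈ Icc 0 C₇,
        ‖deBruijnH t (rodgersTaoZ x κ')‖ ≤ Real.exp (-(π * x / 8) + A * logPlus x ^ 2)) →
      (∀ x : ℝ, C'' ≤ x →
        Real.exp (-(π * x / 8) - A * logPlus x ^ 2) ≤ ‖deBruijnH t (rodgersTaoZ x κ)‖) →
      (∀ x : ℝ, C'' ≤ x →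
        ‖deriv (deBruijnH t) (rodgersTaoZ x κ) / deBruijnH t (rodgersTaoZ x κ) -
            I / 4 * Complex.log (I * rodgersTaoZ x κ / (4 * π))‖ ≤ A * logPlus x / x) →
      ∀ T : ℝ, 0 < T →
        |(deBruijnZeroCount t (Icc 0 T) : ℝ) - rodgersTaoPsi T| ≤ A' * logPlus T ^ 2 := by
  rw [logPlus_eq_logPlus]
  have hπ := Real.pi_pos
  have hl2 : 0 < Real.log 2 := Real.log_pos one_lt_two
  set X₀ : ℝ := max C'' ((8 * κ + 2) ^ 2 + 16) with hX₀
  have hC''X₀ : C'' ≤ X₀ := le_max_left _ _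
  have hX₀κ : (8 * κ + 2) ^ 2 ≤ X₀ := by linarith [le_max_right C'' ((8 * κ + 2) ^ 2 + 16)]
  have hX₀16 : 16 ≤ X₀ := by nlinarith [le_max_right C'' ((8 * κ + 2) ^ 2 + 16), sq_nonneg (8 * κ + 2)]
  have hX₀0 : 0 < X₀ := by linarith
  have hX₀4π : 4 * π ≤ X₀ + 1 := by linarith [Real.pi_lt_d2]
  -- the constants
  set K₀ : ℝ := (A * LFunctions.logPlus (X₀ + 2 * (1 + κ) * (X₀ + 1)) ^ 2 + π * X₀ / 8 + A * LFunctions.logPlus X₀ ^ 2) /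
        Real.log 2 +
      (κ * LFunctions.logPlus (X₀ + 1) + 1 + |rodgersTaoPsi (X₀ + 1)|) +
      (π * (κ * LFunctions.logPlus (X₀ + 1)) / 4 + (4 * A + A) * LFunctions.logPlus (X₀ + 1) ^ 2) / Real.log 2 with hK₀
  set K₁ : ℝ := π * κ / (2 * Real.log 2) + 2 * κ + 1 with hK₁
  set K₂ : ℝ := (4 * A + A) * 4 / Real.log 2 + A * (1 + κ) * 4 with hK₂
  have hK₀0 : 0 ≤ K₀ := by
    have h1 := abs_nonneg (rodgersTaoPsi (X₀ + 1))
    have h2 := logPlus_pos (X₀ + 1)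
    have h3 := logPlus_pos (X₀ + 2 * (1 + κ) * (X₀ + 1))
    have h4 := logPlus_pos X₀
    rw [hK₀]; positivity
  have hK₁0 : 0 ≤ K₁ := by rw [hK₁]; positivity
  refine ⟨K₀ / Real.log 2 ^ 2 + K₁ / Real.log 2 + K₂, fun t hreal hsimple h7 h8 h9 T hT ↦ ?_⟩
  obtain ⟨β, hβ, h⟩ := exists_real_isHadamardSeq hreal
  have hL : 0 < LFunctions.logPlus T := logPlus_pos T
  have hLl : Real.log 2 ≤ LFunctions.logPlus T := log_two_le_logPlus T
  -- absorbing `K₀ + K₁ log₊ T + K₂ log₊² T` into `A′ log₊² T`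
  have hq1 : K₀ ≤ K₀ / Real.log 2 ^ 2 * LFunctions.logPlus T ^ 2 := by
    rw [div_mul_eq_mul_div, le_div_iff₀ (by positivity)]
    exact mul_le_mul_of_nonneg_left (pow_le_pow_left₀ hl2.le hLl 2) hK₀0
  have hq2 : K₁ * LFunctions.logPlus T ≤ K₁ / Real.log 2 * LFunctions.logPlus T ^ 2 := by
    rw [div_mul_eq_mul_div, le_div_iff₀ hl2]
    calc K₁ * LFunctions.logPlus T * Real.log 2 ≤ K₁ * LFunctions.logPlus T * LFunctions.logPlus T :=
          mul_le_mul_of_nonneg_left hLl (mul_nonneg hK₁0 hL.le)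
      _ = K₁ * LFunctions.logPlus T ^ 2 := by ring
  by_cases hTl : X₀ + 1 < T
  · have hbig := abs_count_sub_psi_le_of_large h hβ hreal hsimple hκ hA hC''X₀ hX₀16 hX₀κ hC₇ h7
      h8 h9 hTl
    have e : (A * LFunctions.logPlus (X₀ + 2 * (1 + κ) * (X₀ + 1)) ^ 2 + π * X₀ / 8 + A * LFunctions.logPlus X₀ ^ 2) /
          Real.log 2 +
        (κ * LFunctions.logPlus (X₀ + 1) + 1 + |rodgersTaoPsi (X₀ + 1)|) +
        (π * (κ * LFunctions.logPlus (X₀ + 1)) / 4 + (4 * A + A) * LFunctions.logPlus (X₀ + 1) ^ 2) / Real.log 2 +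
        (π * (κ * LFunctions.logPlus T) / 2 + (4 * A + A) * (4 * LFunctions.logPlus T ^ 2)) / Real.log 2 +
        2 * (κ * LFunctions.logPlus T) + LFunctions.logPlus T + A * (1 + κ) * (4 * LFunctions.logPlus T ^ 2) =
        K₀ + K₁ * LFunctions.logPlus T + K₂ * LFunctions.logPlus T ^ 2 := by
      rw [hK₀, hK₁, hK₂]
      field_simp
      ring
    have hbig' := hbig.trans e.le
    linarith
  · -- small `T`: both `N_t([0,T])` and `Ψ(T)` are `O(1)`
    have hTle : T ≤ X₀ + 1 := le_of_not_gt hTl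
    have hC₇' : 6 * (1 + κ) * (X₀ + 1) ≤ C₇ := by nlinarith
    have hsm := ncard_small_zeros_mul_log_two_le (t := t) hκ hX₀0 hA h7 hC₇' (h8 X₀ hC''X₀)
    have hfin : {x : ℝ | x ∈ Ioc 0 (X₀ + 1) ∧ deBruijnH t x = 0}.Finite :=
      (finite_real_zeros_deBruijnH_Icc t 0 (X₀ + 1)).subset fun x hx ↦ ⟨⟨hx.1.1.le, hx.1.2⟩, hx.2⟩
    have hsub : deBruijnZeroCount t (Icc 0 T) ≤
        {x : ℝ | x ∈ Ioc 0 (X₀ + 1) ∧ deBruijnH t x = 0}.ncard := by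
      rw [deBruijnZeroCount_eq]
      refine Set.ncard_le_ncard (fun x hx ↦ ⟨⟨lt_of_le_of_ne hx.1.1 ?_, hx.1.2.trans hTle⟩, hx.2⟩) hfin
      intro h0; rw [← h0] at hx; exact deBruijnH_apply_zero_ne_zero t (by simpa using hx.2)
    have hN : (deBruijnZeroCount t (Icc 0 T) : ℝ) ≤
        (A * LFunctions.logPlus (X₀ + 2 * (1 + κ) * (X₀ + 1)) ^ 2 + π * X₀ / 8 + A * LFunctions.logPlus X₀ ^ 2) /
          Real.log 2 := by
      rw [le_div_iff₀ hl2]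
      have : (deBruijnZeroCount t (Icc 0 T) : ℝ) ≤
          ({x : ℝ | x ∈ Ioc 0 (X₀ + 1) ∧ deBruijnH t x = 0}.ncard : ℝ) := by exact_mod_cast hsub
      have := mul_le_mul_of_nonneg_right this hl2.le
      linarith
    have hN0 : 0 ≤ (deBruijnZeroCount t (Icc 0 T) : ℝ) := by positivity
    have hΨ := abs_rodgersTaoPsi_le hT hTle hX₀4π
    have hV : 0 ≤ (π * (κ * LFunctions.logPlus (X₀ + 1)) / 4 + (4 * A + A) * LFunctions.logPlus (X₀ + 1) ^ 2) /
        Real.log 2 := by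
      have := (logPlus_pos (X₀ + 1)).le
      positivity
    have hκL : 0 ≤ κ * LFunctions.logPlus (X₀ + 1) := mul_nonneg hκ.le (logPlus_pos _).le
    have hK₂0 : 0 ≤ K₂ * LFunctions.logPlus T ^ 2 := by rw [hK₂]; positivity
    have hK₁' : 0 ≤ K₁ / Real.log 2 * LFunctions.logPlus T ^ 2 := by positivity
    have hmain : |(deBruijnZeroCount t (Icc 0 T) : ℝ) - rodgersTaoPsi T| ≤ K₀ := by
      have h1 : |(deBruijnZeroCount t (Icc 0 T) : ℝ) - rodgersTaoPsi T| ≤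
          (deBruijnZeroCount t (Icc 0 T) : ℝ) + |rodgersTaoPsi T| := by
        have := abs_sub (deBruijnZeroCount t (Icc 0 T) : ℝ) (rodgersTaoPsi T)
        rwa [abs_of_nonneg hN0] at this
      rw [hK₀]; linarith
    linarith

/-- **Rodgers–Tao 2020, Theorem 3.2 (48) — RH-FREE, over the kernel theorems.** For every `T₀`
there is `A` such that for every `t ∈ [−T₀, 0]` lying above a time with only real zeros
(`∃ t₁ < t`, `H_{t₁}` real-rooted — the `sInf`-free form of `Λ < t`), and every `T > 0`,
`|N_t([0,T]) − Ψ(T)| ≤ A log²₊ T`. Inputs: the ★ kernel theorems `rodgersTao_H_bound_holds` (7),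
`rodgersTao_H_asymp_holds` (8), `rodgersTao_logDeriv_H_asymp_holds` (9) (RT §2, `t ∈ [−T₀,0]`),
de Bruijn monotonicity (`hasOnlyRealZeros_of_exists_lt`) and Csordas–Smith–Varga simplicity
(`csordasSmithVarga_simple_zeros_holds`), fed into `thm32_bigO_of_asymptotics`. This is exactly
the hypothesis `h48` of `cor33_location_of_count_estimate` (eq. (50)), uniformly on `[−T₀, 0]`;
with `cor33_gaps_of_count_estimates` ((52)) and `rodgers_tao_gap_bound_of` (Prop. 13) it completes
the RH-free chain of §§3–5 above a real-rooted time. (For ζ the hypothesis is vacuous at `t < 0`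
since `Λ ≥ 0`, and at `t = 0` it is RH; the as-printed `thm32_bigO` stays VACUOUS-AS-PRINTED.)
[cite: RodgersTaoFMP2020, Theorem 3.2 (48) = Theorem 9 (48) p.23] -/
theorem thm32_bigO_inner (T₀ : ℝ) :
    ∃ A : ℝ, ∀ t ∈ Icc (-T₀) 0, (∃ t₁ : ℝ, t₁ < t ∧ HasOnlyRealZeros (deBruijnH t₁)) →
      ∀ T : ℝ, 0 < T →
        |(deBruijnZeroCount t (Icc 0 T) : ℝ) - rodgersTaoPsi T| ≤ A * logPlus T ^ 2 := by
  rw [logPlus_eq_logPlus]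
  obtain ⟨C'₈, hC'₈, h8all⟩ := rodgersTao_H_asymp_holds T₀
  obtain ⟨C'₉, hC'₉, h9all⟩ := rodgersTao_logDeriv_H_asymp_holds T₀
  set κ : ℝ := max C'₈ C'₉ with hκdef
  have hκ : 0 < κ := lt_max_of_lt_left hC'₈
  obtain ⟨C''₈, A₈, hC''₈, hA₈, h8⟩ := h8all κ
  obtain ⟨C''₉, A₉, hC''₉, hA₉, h9⟩ := h9all κ
  set C'' : ℝ := max C''₈ C''₉ with hC''def
  have hC'' : 0 < C'' := lt_max_of_lt_left hC''₈
  set C₇ : ℝ := 6 * (1 + κ) * (max C'' ((8 * κ + 2) ^ 2 + 16) + 2) with hC₇def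
  obtain ⟨A₇, hA₇, h7⟩ := rodgersTao_H_bound_holds C₇ T₀
  set A : ℝ := max A₇ (max A₈ A₉) with hAdef
  have hA7 : A₇ ≤ A := le_max_left _ _
  have hA8 : A₈ ≤ A := (le_max_left _ _).trans (le_max_right _ _)
  have hA9 : A₉ ≤ A := (le_max_right _ _).trans (le_max_right _ _)
  have hA : 0 ≤ A := hA₇.le.trans hA7
  obtain ⟨A', hA'⟩ := thm32_bigO_of_asymptotics (C₇ := C₇) hκ hC'' hA le_rfl
  refine ⟨A', fun t ht hΛ T hT ↦ hA' t (hasOnlyRealZeros_of_exists_lt hΛ) ?_ ?_ ?_ ?_ T hT⟩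
  · obtain ⟨t₁, ht₁, hr⟩ := hΛ
    exact fun x hx ↦ csordasSmithVarga_simple_zeros_holds t₁ t ht₁ hr x hx
  · intro x hx κ' hκ'
    refine (h7 t ht x hx κ' hκ').trans (Real.exp_le_exp.2 ?_)
    rw [logPlus_eq_logPlus]
    have := mul_le_mul_of_nonneg_right hA7 (sq_nonneg (LFunctions.logPlus x))
    linarith
  · intro x hx
    have hx8 : C''₈ ≤ x := (le_max_left _ _).trans hx
    refine le_trans (Real.exp_le_exp.2 ?_) (h8 t ht x hx8 κ ⟨le_max_left _ _, le_rfl⟩).1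
    rw [logPlus_eq_logPlus]
    have := mul_le_mul_of_nonneg_right hA8 (sq_nonneg (LFunctions.logPlus x))
    linarith
  · intro x hx
    have hx9 : C''₉ ≤ x := (le_max_right _ _).trans hx
    have hx0 : 0 < x := hC''₉.trans_le hx9
    refine (h9 t ht x hx9 κ ⟨le_max_right _ _, le_rfl⟩).trans ?_
    exact div_le_div_of_nonneg_right (mul_le_mul_of_nonneg_right hA9 (logPlus_pos x).le) hx0.le

end RodgersTao2020


end Literature.NumberTheory.LFunctions
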